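import Literature.AlgebraicGeometry.HodgeTheory.WeilClassesFieldOrthogonalCornersParity
import Mathlib.LinearAlgebra.Projection
import HarnessLib

/-!
# Moonen–Zarhin's Criterion (2), TYPE 3 with `m ≥ 2`, THE EXCEPTIONAL ALTERNATIVE: reflections of `S(A)(h)(ℂ)` through
# an orthogonal corner — ODD EXPONENT ⟹ `W_F ⊗ ℂ ⊓ 𝒟ᵐ ⊗ ℂ = ⊥`, and the parity DICHOTOMY (Moonen–Zarhin 1998 §1,
# Criterion (2), case «Y of Type 3, m ≥ 2», on the carrier)

Layer `Literature/AlgebraicGeometry/HodgeTheory`; THEOREMS ONLY — no definition, no named fact, no `sorry` (D-0026, net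
debt 0).  Sequel of the seat's `WeilClassesFieldOrthogonalCornersParity` (the mechanism «`det(u | V_ρ) = ∏_b (±1)^{l_b(ρ)}`,
even exponents ⟹ decomposable») and `WeilClassesFieldDefiniteQuaternionMatricesDecomposable` (the instance on powers).
That file left the EXCEPTIONAL direction open: it needs an element of `S(A)(h)(ℂ)` of determinant `-1` on one corner.
This file constructs it — the REFLECTION `1 - 2Π_π` along a sub-corner — and proves «some exponent `l_b(ρ)` odd ⟹ all
non-zero Weil classes of `F` exceptional», hence, with the previous file, the print's dichotomy as two `iff`s.

## The print

B. J. J. Moonen, Yu. G. Zarhin, *Weil classes on abelian varieties*, J. reine angew. Math. **496** (1998) 83–92 =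
arXiv:alg-geom/9612017 [MoonenZarhin1998WeilClasses] (held text `paper:arxiv-alg-geom_9612017`), §1, VERBATIM.
Criterion (2) (chunk p0003 L46–L60): «Suppose `X` is isogenous to a power `Y^m` of a simple abelian variety `Y` …
Suppose `F ↪ End⁰(X)` is a subfield such that `W_F = ∧^r V_X` consists of Hodge classes … Then either all classes in
`W_F` are decomposable, or all non-zero classes in `W_F` are exceptional; this last possibility occurs precisely in the
following cases: `Y` is of Type 3, `m = 1` and `F ⊄ E`, `Y` is of Type 3, `m ≥ 2` and the integer `2m · [E:ℚ] / [F:ℚ]`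
is odd, …».  Its proof, type 3 with `m ≥ 2` (chunk p0003 L92–L111): «We have `B = M_m(D)`, hence `F ⊆ B`.  The
centralizer `𝒞` of `B` in `End_E(V_X)` is isomorphic to `M_k(D′)` … Let us now show that, in this case, `W_F` consists
of decomposable classes if and only if `2m/[F:E]` is even. … the connected component of the identity `G_div⁰` acts
trivially on `W_F`.  Next consider an embedding `τ : E → ℂ`, and an element `g ∈ G_div^{(τ)}(ℂ)` which is not in the
connected component `(G_div^{(τ)})⁰`.  The `ℂ`-linear extension of the reduced norm to `𝒞 ⊗_{E,τ} ℂ ≅ M_{2k}(ℂ)` is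
nothing but the `ℂ`-linear determinant, so `Nrd_ℂ(g) = det_ℂ(g) = -1`.  (Recall that `G_div^{(τ)} ≅ O_{2k}`.)  It then
follows from the preceding remarks that `g` acts on `W_F ⊗ ℂ` as multiplication by `(-1)^{2m/[F:E]}`, which proves the
assertion.»  The Rosati involution on matrices (chunk p0002 L87–L90): «With `End⁰(X) = M_m(D)`, the Rosati involutions
`∗` and `†` are related by `α† = (α*ⱼᵢ)` for `α = (αᵢⱼ) ∈ M_m(D)`.»  The group (chunk p0002 L66–L71): «`G_div(X) :=
Gl_B(V) ∩ SP(V, φ)` … the centralizer of `B` in `SP(V, φ)`».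
J. S. Milne, *Lefschetz classes on abelian varieties*, Duke Math. J. 96 (1999) [Milne1999LefschetzClasses], §1
pp. 642–644 (`C(A)`, `S(A)`), Thm. 3.2, Cor. 4.5 — the tree's reading of «`G_div` acts trivially on `W_F` ⟺ `W_F ⊆ 𝒟`»
and its negation (`weilClassesField_inf_divisorClassesSpan_eq_bot_iff_exists_detOnEigenspace_ne_one`: for `m ≠ 0`,
`W_F ⊗ ℂ ⊓ 𝒟ᵐ ⊗ ℂ = ⊥` iff SOME `u ∈ S(A)(h)(ℂ)` has `det(u | V_ρ) ≠ 1` at SOME root `ρ`).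

## The carrier dictionary (as in the seat's files)

`V = H¹(A(ℂ); ℂ)`; `F = ℚ(φ)`, `P(φ) = 0`, `P ∈ ℤ[T]` monic irreducible of degree `e`, `e · 2m = 2 dim A`;
`V_ρ = ker(φ^* - ρ)`; `W_F ⊗ ℂ = weilClassesField A φ P (2m)`, `𝒟ᵐ ⊗ ℂ = divisorClassesSpan A.X A.dim m`; `h ∈ B¹ ⊗ ℂ`
with `Q_h = polarizationPairingOne` non-degenerate (alternating on `H¹`: `polarizationPairingOne_swap`);
`S(A)(h)(ℂ) = unitaryCentralizerGroup A h` (automorphisms commuting with EVERY `χ^*` and preserving `Q_h`);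
`det(u | V_ρ) = detOnEigenspace`.  A SYSTEM OF MATRIX BLOCKS `x, y : κ → ι → End V`, `p : κ → End V` (`y_{bi} x_{bj} = δᵢⱼ p_b`,
`y_{bi} x_{b'j} = 0` for `b ≠ b'`, `Σ_{b,i} x_{bi} y_{bi} = 1`; units `x_{bi} y_{bj}`, `Q_b = Σᵢ x_{bi} y_{bi}`, corners
`W_b = p_b V`) is the print's «`B ⊗ ℂ ⊇ ∏_τ Δ_ℂ^{(τ)}`», `b = τ ∈ Σ_E`; an ORTHOGONAL CORNER is a `W_b` with an operator
`s_b` making `β_b(v, w) = Q_h(v, s_b w)` symmetric and non-degenerate on `W_b` (the symmetric form of `Stand` for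
`G_div^{(τ)} ≅ O_{2k}`); THE TYPE-3 ADJOINT STRUCTURE of the units is `Q_h(x_{bk} v, w) = ε_k Q_h(v, s_b y_{bσ(k)} w)`
for an involution `σ` of `ι` and scalars `ε_{σ(k)} = -ε_k` (for the datum `x = (p, tp)`, `y = (p, pt)` of a
Rosati-skew anticommuting pair and its matrix amplification: `x_{(a,0)}† = t y_{(a,1)}`, `x_{(a,1)}† = -t y_{(a,0)}` —
«`α† = (α*ⱼᵢ)`» with `∗` the quaternion conjugation).  THE EXPONENTS: `l_b(ρ) = dim(V_ρ ∩ Q_b V)/dim W_b`; in the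
print, at the place `τ`, `l_τ(ρ) = dim(V_ρ ∩ V^{(τ)})/2k`, `Σ_τ l_τ(ρ) = 2m[E:ℚ]/[F:ℚ]`.  «EVERY PULL-BACK IN THE SPAN
OF THE UNITS» is the hypothesis `End⁰(X) ⊗ ℂ = B ⊗ ℂ = ⊕_τ M(ℂ)`-as-presented, under which the commutant of the units lies
in Milne's `C(A) ⊗ ℂ` and the print's `G_div(X)(ℂ) ∩ {γ†γ = 1}` is `S(A)(h)(ℂ)`.

## What is proved

§1 (namespace `Literature.LinearAlgebra`, any field `K`, `V` finite-dimensional):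
* `det_one_sub_two_smul_of_isIdempotentElem` — `det(1 - 2E) = (-1)^{dim EV}` for an idempotent `E`;
  `det_restrict_one_sub_two_smul_of_isIdempotentElem` — the same on an `E`-invariant subspace `U`, exponent `dim(U ∩ EV)`;
* `sum_mul_corner_mul_mul_self`, `sum_mul_corner_mul_comm_unit`, `mul_comm_of_mem_span_units` — for a corner idempotent
  `π` (`p_b π = π p_b = π = π²`), `Π_π = Σₖ x_{bk} π y_{bk}` is an idempotent commuting with all the units;
* **`bilin_sum_mul_corner_mul_comm`** — for an alternating `Φ` and the type-3 adjoint structure at the block `b`, a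
  `β`-self-adjoint `π` gives a `Φ`-SELF-ADJOINT `Π_π`;
* **`exists_forall_finrank_eigenspace_inf_range_corner_eq`** — THE MORITA RANK IDENTITY FOR A SUB-CORNER: for
  `a = Σ c_{bij} x_{bi} y_{bj}` there are exponents `l_b` with `dim(ker(a - τ) ∩ Π_π V) = l_b · dim πV` for EVERY corner
  idempotent `π` of EVERY block (with `π = p_b`: `dim(ker(a - τ) ∩ Q_b V) = l_b · dim W_b`, the identification of the
  seat's `exists_forall_det_restrict_eigenspace_eq_prod_pow`, whose transplant isomorphism is re-run);
* `exists_rankOne_corner_idempotent_selfAdjoint` — a non-zero orthogonal corner has a rank-one `β`-orthogonal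
  idempotent (`char K ≠ 2`: a non-isotropic vector exists by polarization).
§2 (the carrier):
* **`exists_mem_unitaryCentralizerGroup_coe_eq_one_sub_two_smul`** — for an idempotent `R` commuting with every `χ^*`
  and `Q_h`-self-adjoint, the reflection `1 - 2R` lies in `S(A)(h)(ℂ)` and `det(1 - 2R | V_τ) = (-1)^{dim(V_τ ∩ RV)}`;
* **`weilClassesField_inf_divisorClassesSpan_eq_bot_of_isIdempotentElem_of_odd`** — THE GENERAL CRITERION: such an `R`
  with `dim(V_ρ ∩ RV)` odd at some root ⟹ `W_F ⊗ ℂ ⊓ 𝒟ᵐ ⊗ ℂ = ⊥` (`m ≠ 0`);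
* `weilClassesField_inf_divisorClassesSpan_eq_bot_of_matrixBlocks_of_cornerIdempotent_of_odd` — blocks whose units
  span a space containing every pull-back, adjoint structure at `b₀`, a `β`-self-adjoint corner idempotent `π` with
  `dim(V_ρ ∩ Π_π V)` odd ⟹ exceptional;
* **`weilClassesField_inf_divisorClassesSpan_eq_bot_of_cornerForms_of_odd`** — ORTHOGONAL CORNER `W_{b₀} ≠ 0` WITH ITS
  ADJOINT STRUCTURE AND `l_{b₀}(ρ)` ODD AT SOME ROOT ⟹ `W_F ⊗ ℂ ⊓ 𝒟ᵐ ⊗ ℂ = ⊥`;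
* **`weilClassesField_le_divisorClassesSpan_iff_forall_even_of_cornerForms`**,
  **`weilClassesField_inf_divisorClassesSpan_eq_bot_iff_exists_odd_of_cornerForms`** — THE DICHOTOMY for orthogonal
  corners with adjoint structure at every block, inside the pull-back algebra and exhausting it: `W_F ⊗ ℂ ≤ 𝒟ᵐ ⊗ ℂ` iff
  every `l_b(ρ)` is even; `W_F ⊗ ℂ ⊓ 𝒟ᵐ ⊗ ℂ = ⊥` iff some `l_b(ρ)` is odd (with `W_b ≠ 0`).
§3 (one Morita datum `(x, y, p)` over `ι` with corner operator `t` and adjoint structure, split along the Lagrange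
projectors of a `Q_h`-self-adjoint commuting `T` with simple spectrum — the totally real centre place by place):
**`weilClassesField_inf_divisorClassesSpan_eq_bot_of_moritaData_of_cornerForm_of_symmetric_of_odd`** — every `χ^*` in
`ℂ⟨T, x_a y_b⟩`, and at some root `ρ` and place `z`, `dim(V_ρ ∩ ker(T - z))` an odd multiple of
`dim(pV ∩ ker(T - z)) ≠ 0` ⟹ `W_F ⊗ ℂ ⊓ 𝒟ᵐ ⊗ ℂ = ⊥` (mirror of the seat's `…_of_symmetric_of_even`).

## Relation to the print; scope (honest column)

* As in the seat's earlier rows, the algebraic group `G_div(X)`, `π₀` and the reduced norm are replaced by explicit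
  elements of Milne's `S(A)(h)(ℂ)` acting on `H¹`: the print's `g ∉ (G_div^{(τ)})⁰` with `det_ℂ(g) = -1` is the
  reflection `1 - 2Π_π`, `Π_π = Σₖ x_{τk} π y_{τk}` for a rank-one `β_τ`-orthogonal idempotent `π` of the corner `W_τ`
  (`Stand ⊗ (line) ⊂ Stand ⊗ W^{(τ)}`), and «acts on `W_F ⊗ ℂ` as multiplication by `(-1)^{l}`» is
  `det(1 - 2Π_π | V_ρ) = (-1)^{dim(V_ρ ∩ Π_π V)} = (-1)^{l_τ(ρ)}`.  No Albert type, simplicity or `X ∼ Y^m` is assumed;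
  blocks, corners, adjoint structure and «every pull-back in the span of the units» are HYPOTHESES on operators, to be
  instantiated (the power `A^{n+1}` of a variety with `End⁰(A)` a definite quaternion algebra AS PRESENTED is the
  announced sequel of `WeilClassesFieldDefiniteQuaternionMatricesDecomposable`; it is where «`End⁰(X) = M_m(D)`» enters).
* THE PARITY CONDITION is per place and per root (`l_b(ρ)` odd for SOME `b`, `ρ`), the print's integer being
  `Σ_b l_b(ρ) = 2m[E:ℚ]/[F:ℚ]`; the two agree when `E ⊆ F` or `[E:ℚ] = 1` — see the module docstring of
  `WeilClassesFieldOrthogonalCornersParity`, «Relation to the print», for the comparison and an example where they differ.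
  Nothing in the Lean statements depends on that remark.
* `h` is any class in `B¹ ⊗ ℂ` with `Q_h` non-degenerate; `m ≠ 0` throughout the exceptional statements (for `m = 0`,
  `W_F` is the line of `H⁰` and nothing is exceptional).

## References

* [MoonenZarhin1998WeilClasses] B. J. J. Moonen, Yu. G. Zarhin, Weil classes on abelian varieties, J. reine angew.
  Math. 496 (1998) 83–92; arXiv:alg-geom/9612017: §1 (chunk p0002 L54–L118, p0003 L1–L12), Criterion (2) and its proof,
  type 3 (chunk p0003 L46–L60, L92–L111; p0004 L1–L27).
* [Milne1999LefschetzClasses] J. S. Milne, Lefschetz classes on abelian varieties, Duke Math. J. 96 (1999) 639–675,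
  §1 pp. 642–644, Thm. 3.2, Cor. 4.5.
* [McconnellRobson2001] J. C. McConnell, J. C. Robson, Noncommutative Noetherian Rings, GSM 30 (AMS 2001), 3.5.5–3.5.7
  (Morita context of a full idempotent; corners `eRe`).
* [HornJohnson2013] R. A. Horn, C. R. Johnson, Matrix Analysis, 2nd ed. (CUP 2013), §0.8–§0.9 (determinants, block
  diagonal matrices), §1.1, §1.3 (idempotents, invariant subspaces), §2.1 (orthogonal matrices), §4.5 (congruence of
  symmetric forms).
* [LangeBirkenhake1992] H. Lange, Ch. Birkenhake, Complex Abelian Varieties, Grundlehren 302 (1992), Ch. 5 §5 (type III: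
  the Rosati involution is quaternion conjugation on the factors; held PDF p. 138).

## Provenance

Lane `lit-hodgefound` (Track 2, Layer A), prover seat `lit-hodgefound-p21` (generation 23), row g23-#3; successor note
(a) of generation 22, exceptional half.
-/

noncomputable section

open Module

/-! ### §1 Linear algebra: the determinant of a reflection, the Morita rank identity for a sub-corner, rank-one
orthogonal idempotents -/

namespace Literature.LinearAlgebra

section Reflection

variable {K V : Type*} [Field K] [AddCommGroup V] [Module K V]

/-- **`det(1 - 2E) = (-1)^{rank E}` for an idempotent `E`** (`V = EV ⊕ ker E`, on which `1 - 2E = (-1) ⊕ 1`).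
[cite: HornJohnson2013, §0.9.2 (determinant of a block diagonal matrix) and §1.1 (idempotents, P² = P)] -/
theorem det_one_sub_two_smul_of_isIdempotentElem [FiniteDimensional K V] {E : Module.End K V}
    (hE : IsIdempotentElem E) :
    LinearMap.det (1 - (2 : K) • E) = (-1) ^ Module.finrank K (LinearMap.range E) := by
  have hc : IsCompl (LinearMap.range E) (LinearMap.ker E) := LinearMap.IsIdempotentElem.isCompl hE
  have hconj : (1 - (2 : K) • E) ∘ₗ ((LinearMap.range E).prodEquivOfIsCompl _ hc).toLinearMap =
      ((LinearMap.range E).prodEquivOfIsCompl _ hc).toLinearMap ∘ₗ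
        LinearMap.prodMap (-LinearMap.id) LinearMap.id := by
    refine LinearMap.ext fun z ↦ ?_
    obtain ⟨⟨u, hu⟩, ⟨v, hv⟩⟩ := z
    rw [LinearMap.comp_apply, LinearMap.comp_apply, LinearEquiv.coe_coe, Submodule.coe_prodEquivOfIsCompl',
      Submodule.coe_prodEquivOfIsCompl', LinearMap.prodMap_apply, LinearMap.neg_apply, LinearMap.id_apply,
      LinearMap.id_apply, Submodule.coe_neg, LinearMap.sub_apply, Module.End.one_apply, LinearMap.smul_apply,
      map_add, (LinearMap.IsIdempotentElem.mem_range_iff hE).1 hu, LinearMap.mem_ker.1 hv, add_zero, two_smul]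
    abel
  have hneg : (-LinearMap.id : LinearMap.range E →ₗ[K] LinearMap.range E) = (-1 : K) • LinearMap.id :=
    (neg_one_smul K _).symm
  rw [(LinearEquiv.eq_comp_toLinearMap_symm _ _).2 hconj, LinearMap.comp_assoc, LinearMap.det_conj,
    LinearMap.det_prodMap, LinearMap.det_id, mul_one, hneg, LinearMap.det_smul, LinearMap.det_id, mul_one]

/-- The range of the restriction of an idempotent `E` to an invariant subspace `U` is `U ∩ EV`, read in `U`.
[cite: HornJohnson2013, §1.1, §1.3 (invariant subspaces)] -/
theorem finrank_range_restrict_of_isIdempotentElem [FiniteDimensional K V] {E : Module.End K V}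
    (hE : IsIdempotentElem E) {U : Submodule K V} (hU : Set.MapsTo E U U) :
    Module.finrank K (LinearMap.range (E.restrict hU)) = Module.finrank K ↥(U ⊓ LinearMap.range E) := by
  have hmap : (LinearMap.range (E.restrict hU)).map U.subtype = U ⊓ LinearMap.range E := by
    refine le_antisymm ?_ ?_
    · rintro _ ⟨w, ⟨z, rfl⟩, rfl⟩
      exact ⟨(E.restrict hU z).2, ⟨z, rfl⟩⟩
    · rintro v ⟨hvU, hvE⟩
      refine ⟨⟨v, hvU⟩, ⟨⟨v, hvU⟩, Subtype.ext ?_⟩, rfl⟩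
      rw [LinearMap.coe_restrict_apply]
      exact (LinearMap.IsIdempotentElem.mem_range_iff hE).1 hvE
  rw [← hmap, Submodule.finrank_map_subtype_eq]

/-- **`det((1 - 2E) | U) = (-1)^{dim(U ∩ EV)}`** for an idempotent `E` and an `E`-invariant subspace `U`.
[cite: HornJohnson2013, §0.9.2, §1.1, §1.3] -/
theorem det_restrict_one_sub_two_smul_of_isIdempotentElem [FiniteDimensional K V] {E : Module.End K V}
    (hE : IsIdempotentElem E) {U : Submodule K V} (hU : Set.MapsTo E U U)
    (hU' : Set.MapsTo (1 - (2 : K) • E : Module.End K V) U U) :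
    LinearMap.det ((1 - (2 : K) • E).restrict hU') = (-1) ^ Module.finrank K ↥(U ⊓ LinearMap.range E) := by
  have hres : (1 - (2 : K) • E).restrict hU' = 1 - (2 : K) • E.restrict hU := by
    refine LinearMap.ext fun z ↦ Subtype.ext ?_
    rw [LinearMap.coe_restrict_apply, LinearMap.sub_apply, LinearMap.smul_apply, Module.End.one_apply,
      LinearMap.sub_apply, LinearMap.smul_apply, Module.End.one_apply, Submodule.coe_sub, Submodule.coe_smul,
      LinearMap.coe_restrict_apply]
  have hE' : IsIdempotentElem (E.restrict hU) := by
    refine LinearMap.ext fun z ↦ Subtype.ext ?_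
    rw [Module.End.mul_apply, LinearMap.coe_restrict_apply, LinearMap.coe_restrict_apply, ← Module.End.mul_apply,
      hE.eq]
  rw [hres, det_one_sub_two_smul_of_isIdempotentElem hE', finrank_range_restrict_of_isIdempotentElem hE hU]

end Reflection

section Blocks

variable {K V : Type*} [Field K] [AddCommGroup V] [Module K V]
variable {κ ι : Type*} [Fintype κ] [DecidableEq κ] [Fintype ι] [DecidableEq ι]
variable {x y : κ → ι → Module.End K V} {p : κ → Module.End K V}

omit [Fintype κ] [DecidableEq κ] in
/-- The sub-corner operator `Π_π = Σᵢ x_{bi} π y_{bi}` of a corner idempotent `π` (`p_b π = π = π²`) is idempotent.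
[cite: McconnellRobson2001, 3.5.5–3.5.7] -/
theorem sum_mul_corner_mul_mul_self (hxy : ∀ b i j, y b i * x b j = if i = j then p b else 0) {b : κ}
    {π : Module.End K V} (hpπ : p b * π = π) (hππ : π * π = π) :
    (∑ i, x b i * π * y b i) * (∑ i, x b i * π * y b i) = ∑ i, x b i * π * y b i := by
  have hunit : ∀ i k, x b i * π * y b i * (x b k * π * y b k) = if i = k then x b i * π * y b i else 0 := by
    intro i k
    simp only [mul_assoc]
    rw [← mul_assoc (y b i) (x b k), hxy]
    split_ifs with hik
    · subst hik
      rw [← mul_assoc (p b) π, hpπ, ← mul_assoc π π, hππ]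
    · rw [zero_mul, mul_zero, mul_zero]
  rw [Finset.sum_mul_sum]
  refine Finset.sum_congr rfl fun i _ ↦ ?_
  rw [Finset.sum_eq_single i (fun k _ hk ↦ by rw [hunit, if_neg (Ne.symm hk)])
    fun hi ↦ absurd (Finset.mem_univ i) hi, hunit, if_pos rfl]

omit [Fintype κ] in
/-- `Π_π = Σₖ x_{bk} π y_{bk}` commutes with every matrix unit `x_{b'i} y_{b'j}` (`p_b π = π p_b = π`): it lies in the
commutant of the blocks (the print's `𝒞 ∋ g`). [cite: McconnellRobson2001, 3.5.5–3.5.7]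
[cite: MoonenZarhin1998WeilClasses, §1 proof of Criterion (2), type 3: «The centralizer 𝒞 of B in End_E(V_X) is isomorphic to M_k(D′)» (chunk p0003 L94–L97)] -/
theorem sum_mul_corner_mul_comm_unit (hxy : ∀ b i j, y b i * x b j = if i = j then p b else 0)
    (hcross : ∀ b b', b ≠ b' → ∀ i j, y b i * x b' j = 0) {b : κ} {π : Module.End K V} (hpπ : p b * π = π)
    (hπp : π * p b = π) (b' : κ) (i j : ι) :
    (∑ k, x b k * π * y b k) * (x b' i * y b' j) = x b' i * y b' j * ∑ k, x b k * π * y b k := by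
  rw [Finset.sum_mul, Finset.mul_sum]
  by_cases hb : b' = b
  · subst hb
    have h1 : ∑ k, x b' k * π * y b' k * (x b' i * y b' j) = x b' i * π * y b' j := by
      rw [Finset.sum_eq_single i (fun k _ hk ↦ ?_) fun hi ↦ absurd (Finset.mem_univ i) hi]
      · simp only [mul_assoc]
        rw [← mul_assoc (y b' i) (x b' i), hxy, if_pos rfl, ← mul_assoc π (p b'), hπp]
      · simp only [mul_assoc]
        rw [← mul_assoc (y b' k) (x b' i), hxy, if_neg hk, zero_mul, mul_zero, mul_zero]
    have h2 : ∑ k, x b' i * y b' j * (x b' k * π * y b' k) = x b' i * π * y b' j := by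
      rw [Finset.sum_eq_single j (fun k _ hk ↦ ?_) fun hj ↦ absurd (Finset.mem_univ j) hj]
      · simp only [mul_assoc]
        rw [← mul_assoc (y b' j) (x b' j), hxy, if_pos rfl, ← mul_assoc (p b') π, hpπ]
      · simp only [mul_assoc]
        rw [← mul_assoc (y b' j) (x b' k), hxy, if_neg (Ne.symm hk), zero_mul, mul_zero]
    rw [h1, h2]
  · have h1 : ∑ k, x b k * π * y b k * (x b' i * y b' j) = 0 := Finset.sum_eq_zero fun k _ ↦ by
      simp only [mul_assoc]
      rw [← mul_assoc (y b k) (x b' i), hcross b b' (Ne.symm hb), zero_mul, mul_zero, mul_zero]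
    have h2 : ∑ k, x b' i * y b' j * (x b k * π * y b k) = 0 := Finset.sum_eq_zero fun k _ ↦ by
      simp only [mul_assoc]
      rw [← mul_assoc (y b' j) (x b k), hcross b' b hb, zero_mul, mul_zero]
    rw [h1, h2]

omit [Fintype κ] [DecidableEq κ] [Fintype ι] [DecidableEq ι] in
/-- An operator commuting with all the units commutes with their span. [cite: McconnellRobson2001, 3.5.5–3.5.6] -/
theorem mul_comm_of_mem_span_units {R f : Module.End K V} (hR : ∀ b i j, R * (x b i * y b j) = x b i * y b j * R)
    (hf : f ∈ Submodule.span K (Set.range fun t : κ × ι × ι ↦ x t.1 t.2.1 * y t.1 t.2.2)) : R * f = f * R := by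
  induction hf using Submodule.span_induction with
  | mem g hg =>
    obtain ⟨t, rfl⟩ := hg
    exact hR t.1 t.2.1 t.2.2
  | zero => rw [mul_zero, zero_mul]
  | add g g' _ _ hg hg' => rw [mul_add, add_mul, hg, hg']
  | smul c g _ hg => rw [mul_smul_comm, smul_mul_assoc, hg]

omit [Fintype κ] [DecidableEq κ] [DecidableEq ι] in
/-- **`Π_π` IS SELF-ADJOINT FOR AN ALTERNATING `Φ` UNDER THE TYPE-3 ADJOINT STRUCTURE.**  Let `Φ` be alternating
(`Φ(v, w) = -Φ(w, v)`), let the corner `W_b = p_b V` carry the symmetric form `β(v, w) = Φ(v, s w)` and let the units of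
the block `b` have the adjoints `Φ(x_{bk} v, w) = ε_k Φ(v, s y_{bσ(k)} w)` for an involution `σ` of `ι` and scalars with
`ε_{σ(k)} = -ε_k` (for `M_m(D) ⊗ ℂ`, `D` definite quaternion with its conjugation: `x_{(a,0)}† = t y_{(a,1)}`,
`x_{(a,1)}† = -t y_{(a,0)}`).  If `π` is `β`-self-adjoint on `W_b` (`p_b π = π`), then `Π_π = Σₖ x_{bk} π y_{bk}` is
`Φ`-self-adjoint: `Φ(Π_π v, w) = Φ(v, Π_π w)`.
[cite: MoonenZarhin1998WeilClasses, §1 «With End⁰(X) = M_m(D), the Rosati involutions ∗ and † are related by α† = (α*ⱼᵢ)» (chunk p0002 L87–L90) and proof of Criterion (2), type 3 (chunk p0003 L92–L111)]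
[cite: LangeBirkenhake1992, Ch. 5 §5 (type III: the Rosati involution is quaternion conjugation; PDF p. 138)] -/
theorem bilin_sum_mul_corner_mul_comm {N : Type*} [AddCommGroup N] [Module K N] (Φ : V →ₗ[K] V →ₗ[K] N)
    (hΦalt : ∀ v w, Φ v w = -Φ w v) {b : κ} {π s : Module.End K V} {σ : ι → ι} {ε : ι → K}
    (hpπ : p b * π = π) (hpy : ∀ i, p b * y b i = y b i)
    (hsymm : ∀ v ∈ LinearMap.range (p b), ∀ w ∈ LinearMap.range (p b), Φ v (s w) = Φ w (s v))
    (hadj : ∀ k v w, Φ (x b k v) w = ε k • Φ v (s (y b (σ k) w))) (hσ : Function.Involutive σ)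
    (hε : ∀ k, ε (σ k) = -ε k)
    (hπβ : ∀ v ∈ LinearMap.range (p b), ∀ w ∈ LinearMap.range (p b), Φ (π v) (s w) = Φ v (s (π w)))
    (v w : V) :
    Φ ((∑ k, x b k * π * y b k) v) w = Φ v ((∑ k, x b k * π * y b k) w) := by
  have hW : ∀ i u, y b i u ∈ LinearMap.range (p b) := fun i u ↦ ⟨y b i u, by rw [← Module.End.mul_apply, hpy]⟩
  have hπW : ∀ u, π u ∈ LinearMap.range (p b) := fun u ↦ ⟨π u, by rw [← Module.End.mul_apply, hpπ]⟩
  have lhs : Φ ((∑ k, x b k * π * y b k) v) w = ∑ k, ε k • Φ (y b k v) (s (π (y b (σ k) w))) := by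
    rw [LinearMap.sum_apply, map_sum, LinearMap.sum_apply]
    refine Finset.sum_congr rfl fun k _ ↦ ?_
    rw [Module.End.mul_apply, Module.End.mul_apply, hadj, hπβ _ (hW k v) _ (hW (σ k) w)]
  have rhs : Φ v ((∑ k, x b k * π * y b k) w) = ∑ k, -(ε k • Φ (y b (σ k) v) (s (π (y b k w)))) := by
    rw [LinearMap.sum_apply, map_sum]
    refine Finset.sum_congr rfl fun k _ ↦ ?_
    rw [Module.End.mul_apply, Module.End.mul_apply, hΦalt, hadj, hsymm _ (hπW _) _ (hW (σ k) v)]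
  rw [lhs, rhs]
  exact Fintype.sum_bijective σ hσ.bijective _ _ fun k ↦ by rw [hσ k, hε, neg_smul, neg_neg]

/-- **THE MORITA RANK IDENTITY FOR A SUB-CORNER — `dim(ker(a - τ) ∩ Π_π V) = l_b · rank π`.**  For a system of matrix
blocks `x, y, p` (`y_{bi} x_{bj} = δᵢⱼ p_b`, `y_{bi} x_{b'j} = 0` for `b ≠ b'`, `Σ_{b,i} x_{bi} y_{bi} = 1`) and an element
`a = Σ c_{bij} x_{bi} y_{bj}` of their span there are exponents `l_b` (the multiplicity of `τ` as an eigenvalue of the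
coefficient matrix `c_b`) such that for EVERY block `b` and EVERY idempotent `π` of the corner `W_b = p_b V`
(`p_b π = π p_b = π = π²`) the idempotent `Π_π = Σᵢ x_{bi} π y_{bi}` (the print's `1 ⊗ π` on `Stand ⊗ W^{(τ)}`) has
`dim(ker(a - τ) ∩ Π_π V) = l_b · dim πV`.  With `π = p_b` (`Π_π = Q_b`) this is the identification
`l_b · dim W_b = dim(ker(a - τ) ∩ Q_b V)` of the seat's `exists_forall_det_restrict_eigenspace_eq_prod_pow`, whose
transplant isomorphism `Θ : Π_b W_b^{l_b} ≅ ker(a - τ)` is re-run here: `Θ` maps `(πW_b)^{l_b}` onto `ker(a - τ) ∩ Π_π V`.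
[cite: McconnellRobson2001, 3.5.5–3.5.7 (Morita context of a full idempotent)]
[cite: MoonenZarhin1998WeilClasses, §1 «V ⊗ ℂ splits … G_div^{(τ)}», Table 2 (chunk p0002 L104–L118)] -/
theorem exists_forall_finrank_eigenspace_inf_range_corner_eq [FiniteDimensional K V]
    (hxy : ∀ b i j, y b i * x b j = if i = j then p b else 0)
    (hcross : ∀ b b', b ≠ b' → ∀ i j, y b i * x b' j = 0) (hsum : ∑ b, ∑ i, x b i * y b i = 1)
    (c : κ → Matrix ι ι K) {a : Module.End K V} (ha : a = ∑ b, ∑ i, ∑ j, c b i j • (x b i * y b j)) (τ : K) :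
    ∃ l : κ → ℕ, ∀ (b : κ) (π : Module.End K V), p b * π = π → π * p b = π → π * π = π →
      Module.finrank K ↥(a.eigenspace τ ⊓ LinearMap.range (∑ i, x b i * π * y b i)) =
        l b * Module.finrank K (LinearMap.range π) := by
  classical
  set Vτ : Submodule K V := a.eigenspace τ with hVτdef
  let W : κ → Submodule K V := fun b ↦ LinearMap.range (p b)
  have hxp : ∀ b i, x b i * p b = x b i := mul_idem_of_matrixBlocks hxy hcross hsum
  have hpy : ∀ b i, p b * y b i = y b i := idem_mul_of_matrixBlocks hxy hcross hsum
  have hpp : ∀ b, p b * p b = p b := idem_of_matrixBlocks hxy hsum hxp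
  have hpW : ∀ b, ∀ w ∈ W b, p b w = w := by
    rintro b _ ⟨v, rfl⟩
    rw [← Module.End.mul_apply, hpp]
  have hyW : ∀ b i (v : V), y b i v ∈ W b := fun b i v ↦ ⟨y b i v, by rw [← Module.End.mul_apply, hpy]⟩
  have hyx : ∀ b i j (v : V), y b i (x b j v) = if i = j then p b v else 0 := by
    intro b i j v
    rw [← Module.End.mul_apply, hxy]
    split_ifs <;> rfl
  have hyx' : ∀ b b', b ≠ b' → ∀ i j (v : V), y b i (x b' j v) = 0 := by
    intro b b' hb i j v
    rw [← Module.End.mul_apply, hcross b b' hb, LinearMap.zero_apply]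
  -- the eigenvectors of the coefficient matrices `c b`
  let L : κ → Submodule K (ι → K) := fun b ↦ Module.End.eigenspace (Matrix.toLin' (c b)) τ
  have hLmem : ∀ b (ξ : ι → K), ξ ∈ L b ↔ ∀ i, ∑ k, c b i k * ξ k = τ * ξ i := by
    intro b ξ
    rw [Module.End.mem_eigenspace_iff, Matrix.toLin'_apply, funext_iff]
    refine forall_congr' fun i ↦ ?_
    rw [Matrix.mulVec, dotProduct, Pi.smul_apply, smul_eq_mul]
  let l : κ → ℕ := fun b ↦ Module.finrank K (L b)
  let bL := fun b ↦ Module.finBasis K (L b)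
  let bW := fun b ↦ Module.finBasis K (W b)
  let ξ : ∀ b, Fin (l b) → ι → K := fun b α ↦ (bL b α : ι → K)
  have hξ : ∀ b α i, ∑ k, c b i k * ξ b α k = τ * ξ b α i := fun b α ↦ (hLmem b _).1 (bL b α).2
  -- the transplant maps `M_{bα} = Σ_k ξ_{bα}(k) x_{bk}`
  let M : ∀ b, Fin (l b) → Module.End K V := fun b α ↦ ∑ k, ξ b α k • x b k
  have hMapply : ∀ b α v, M b α v = ∑ k, ξ b α k • x b k v := fun b α v ↦ by
    simp only [M, LinearMap.sum_apply, LinearMap.smul_apply]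
  have hyM : ∀ b k α (v : V), y b k (M b α v) = ξ b α k • p b v := by
    intro b k α v
    rw [hMapply, map_sum]
    simp_rw [map_smul, hyx, smul_ite, smul_zero]
    rw [Finset.sum_ite_eq, if_pos (Finset.mem_univ _)]
  have hyM' : ∀ b b', b ≠ b' → ∀ k α (v : V), y b k (M b' α v) = 0 := by
    intro b b' hb k α v
    rw [hMapply, map_sum]
    exact Finset.sum_eq_zero fun m _ ↦ by rw [map_smul, hyx' b b' hb, smul_zero]
  have haX : ∀ b k (w : V), p b w = w → a (x b k w) = ∑ i, c b i k • x b i w := by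
    intro b k w hw
    rw [ha, LinearMap.sum_apply, Finset.sum_eq_single b]
    · rw [LinearMap.sum_apply]
      refine Finset.sum_congr rfl fun i _ ↦ ?_
      rw [LinearMap.sum_apply]
      simp_rw [LinearMap.smul_apply, Module.End.mul_apply, hyx, apply_ite (x b i), map_zero, smul_ite, smul_zero]
      rw [Finset.sum_ite_eq' Finset.univ k, if_pos (Finset.mem_univ _), hw]
    · intro b' _ hb'
      rw [LinearMap.sum_apply]
      exact Finset.sum_eq_zero fun i _ ↦ by
        rw [LinearMap.sum_apply]
        exact Finset.sum_eq_zero fun j _ ↦ by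
          rw [LinearMap.smul_apply, Module.End.mul_apply, hyx' b' b hb', map_zero, smul_zero]
    · exact fun hb ↦ absurd (Finset.mem_univ b) hb
  have haM : ∀ b α (w : V), w ∈ W b → a (M b α w) = τ • M b α w := by
    intro b α w hw
    rw [hMapply, map_sum, Finset.smul_sum]
    simp_rw [map_smul, haX b _ w (hpW b w hw), Finset.smul_sum, smul_smul, mul_comm (ξ b α _) (c b _ _)]
    rw [Finset.sum_comm]
    exact Finset.sum_congr rfl fun i _ ↦ by rw [← Finset.sum_smul, hξ b α i]
  have hMV : ∀ b α (w : V), w ∈ W b → M b α w ∈ Vτ := fun b α w hw ↦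
    Module.End.mem_eigenspace_iff.2 (haM b α w hw)
  -- the central idempotents `Q_b = Σ_i x_{bi} y_{bi}` on the transplants
  have hQM : ∀ b₀ b α (w : V), w ∈ W b → (∑ i, x b₀ i * y b₀ i) (M b α w) = if b = b₀ then M b α w else 0 := by
    intro b₀ b α w hw
    rw [LinearMap.sum_apply]
    simp_rw [Module.End.mul_apply]
    split_ifs with hb
    · subst hb
      conv_rhs => rw [hMapply]
      exact Finset.sum_congr rfl fun i _ ↦ by rw [hyM, map_smul, hpW _ w hw]
    · exact Finset.sum_eq_zero fun i _ ↦ by rw [hyM' b₀ b (Ne.symm hb), map_zero]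
  -- `Θ : Π_{(b,α)} W_b → V_τ`, `f ↦ Σ_{(b,α)} M_{bα} (f (b,α))`
  let Θ₀ : (∀ s : (Σ b, Fin (l b)), W s.1) →ₗ[K] V :=
    ∑ s : (Σ b, Fin (l b)), (M s.1 s.2 ∘ₗ (W s.1).subtype) ∘ₗ LinearMap.proj s
  have hΘ₀ : ∀ f, Θ₀ f = ∑ s : (Σ b, Fin (l b)), M s.1 s.2 (f s) := fun f ↦ by
    simp only [Θ₀, LinearMap.sum_apply, LinearMap.comp_apply, LinearMap.proj_apply, Submodule.subtype_apply]
  let Θ : (∀ s : (Σ b, Fin (l b)), W s.1) →ₗ[K] Vτ :=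
    Θ₀.codRestrict Vτ fun f ↦ by rw [hΘ₀]; exact Submodule.sum_mem _ fun s _ ↦ hMV s.1 s.2 _ (f s).2
  have hΘ : ∀ f, (Θ f : V) = ∑ s : (Σ b, Fin (l b)), M s.1 s.2 (f s) := fun f ↦ hΘ₀ f
  have hΘ' : ∀ f, (Θ f : V) = ∑ b, ∑ α, M b α (f ⟨b, α⟩) := fun f ↦ by
    rw [hΘ, ← Finset.univ_sigma_univ, Finset.sum_sigma]
  -- blockwise coordinates: `y_{bk} (Θ f) = Σ_α ξ_{bα}(k) f_{bα}`
  have hyΘ : ∀ f b k, y b k (Θ f : V) = ∑ α, ξ b α k • (f ⟨b, α⟩ : V) := by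
    intro f b k
    rw [hΘ', map_sum, Finset.sum_eq_single b]
    · rw [map_sum]
      exact Finset.sum_congr rfl fun α _ ↦ by rw [hyM, hpW b _ (f ⟨b, α⟩).2]
    · intro b' _ hb'
      rw [map_sum]
      exact Finset.sum_eq_zero fun α _ ↦ hyM' b b' hb'.symm _ _ _
    · exact fun hb ↦ absurd (Finset.mem_univ b) hb
  -- `Σ_α ξ_{bα}(k) • w_α = 0` for all `k` forces `w = 0` (one block)
  have hsep₁ : ∀ b (g : Fin (l b) → W b), (∀ k, ∑ α, ξ b α k • (g α : V) = 0) → g = 0 := by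
    intro b g hg
    have hco : ∀ j α, (bW b).repr (g α) j = 0 := by
      intro j
      have hlin : ∑ α, (bW b).repr (g α) j • bL b α = 0 := by
        apply Subtype.ext
        rw [Submodule.coe_sum, Submodule.coe_zero]
        funext k
        simp only [Finset.sum_apply, Submodule.coe_smul, Pi.smul_apply, smul_eq_mul, Pi.zero_apply]
        have hk' : (∑ α, ξ b α k • g α : W b) = 0 := by
          apply Subtype.ext
          rw [Submodule.coe_sum, Submodule.coe_zero]
          simpa only [Submodule.coe_smul] using hg k
        have := congrArg (fun w : W b ↦ (bW b).repr w j) hk'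
        simp only [map_sum, map_smul, Finsupp.coe_finsetSum, Finsupp.coe_smul, Finset.sum_apply,
          Pi.smul_apply, smul_eq_mul, map_zero, Finsupp.coe_zero, Pi.zero_apply] at this
        simpa only [mul_comm] using this
      exact Fintype.linearIndependent_iff.1 (bL b).linearIndependent _ hlin
    funext α
    exact (bW b).ext_elem fun j ↦ by rw [hco j α, Pi.zero_apply, map_zero, Finsupp.zero_apply]
  have hsep : ∀ f : (∀ s : (Σ b, Fin (l b)), W s.1),
      (∀ b k, ∑ α, ξ b α k • (f ⟨b, α⟩ : V) = 0) → f = 0 := by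
    intro f hf
    funext ⟨b, α⟩
    have h := congrFun (hsep₁ b (fun α ↦ f ⟨b, α⟩) (hf b)) α
    rw [h]
    rfl
  have hΘinj : Function.Injective Θ := by
    rw [← LinearMap.ker_eq_bot, LinearMap.ker_eq_bot']
    intro f hf
    refine hsep f fun b k ↦ ?_
    rw [← hyΘ, hf, Submodule.coe_zero, map_zero]
  have hΘsurj : Function.Surjective Θ := by
    rintro ⟨v, hv⟩
    have hav : a v = τ • v := Module.End.mem_eigenspace_iff.1 hv
    -- `Σ_m c_{bkm} • y_{bm} v = τ • y_{bk} v`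
    have hK5 : ∀ b k, ∑ m, c b k m • y b m v = τ • y b k v := by
      intro b k
      have h := congrArg (y b k) hav
      rw [map_smul, ha, LinearMap.sum_apply, map_sum, Finset.sum_eq_single b] at h
      · rw [LinearMap.sum_apply, map_sum] at h
        simp_rw [LinearMap.sum_apply, map_sum, LinearMap.smul_apply, map_smul, Module.End.mul_apply, hyx,
          smul_ite, smul_zero] at h
        rw [Finset.sum_comm] at h
        have hpyv : ∀ m, p b (y b m v) = y b m v := fun m ↦ hpW b _ (hyW b m v)
        simpa only [Finset.sum_ite_eq, Finset.mem_univ, if_true, hpyv] using h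
      · intro b' _ hb'
        rw [LinearMap.sum_apply, map_sum]
        exact Finset.sum_eq_zero fun i _ ↦ by
          rw [LinearMap.sum_apply, map_sum]
          exact Finset.sum_eq_zero fun j _ ↦ by
            rw [LinearMap.smul_apply, map_smul, Module.End.mul_apply, hyx' b b' hb'.symm, smul_zero]
      · exact fun hb ↦ absurd (Finset.mem_univ b) hb
    let g : ∀ b, ι → Fin (Module.finrank K (W b)) → K := fun b k j ↦ (bW b).repr ⟨y b k v, hyW b k v⟩ j
    have hgL : ∀ b j, (fun k ↦ g b k j) ∈ L b := by
      intro b j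
      refine (hLmem b _).2 fun k ↦ ?_
      have h' : (∑ m, c b k m • (⟨y b m v, hyW b m v⟩ : W b)) = τ • ⟨y b k v, hyW b k v⟩ := by
        apply Subtype.ext
        rw [Submodule.coe_sum, Submodule.coe_smul]
        simpa only [Submodule.coe_smul] using hK5 b k
      have := congrArg (fun w : W b ↦ (bW b).repr w j) h'
      simpa only [map_sum, map_smul, Finsupp.coe_finsetSum, Finsupp.coe_smul, Finset.sum_apply,
        Pi.smul_apply, smul_eq_mul] using this
    let r : ∀ b, Fin (l b) → Fin (Module.finrank K (W b)) → K := fun b α j ↦ (bL b).repr ⟨_, hgL b j⟩ α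
    have hgr : ∀ b k j, g b k j = ∑ α, r b α j * ξ b α k := by
      intro b k j
      have h := (bL b).sum_repr ⟨_, hgL b j⟩
      have h' := congrArg (fun z : L b ↦ (z : ι → K) k) h
      simp only [Submodule.coe_sum, Submodule.coe_smul, Finset.sum_apply, Pi.smul_apply, smul_eq_mul] at h'
      exact h'.symm
    have hv1 : v = ∑ b, ∑ k, x b k (y b k v) := by
      conv_lhs => rw [← Module.End.one_apply (M := V) (R := K) v, ← hsum]
      rw [LinearMap.sum_apply]
      refine Finset.sum_congr rfl fun b _ ↦ ?_
      rw [LinearMap.sum_apply]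
      rfl
    have hv2 : ∀ b k, y b k v = ∑ j, g b k j • (bW b j : V) := by
      intro b k
      have h := (bW b).sum_repr ⟨y b k v, hyW b k v⟩
      have h' := congrArg Subtype.val h
      rw [Submodule.coe_sum] at h'
      simpa only [Submodule.coe_smul] using h'.symm
    refine ⟨fun s ↦ ∑ j, r s.1 s.2 j • bW s.1 j, Subtype.ext ?_⟩
    rw [hΘ']
    refine (?_ : _ = ∑ b, ∑ k, x b k (y b k v)).trans hv1.symm
    refine Finset.sum_congr rfl fun b _ ↦ ?_
    simp_rw [hv2, map_sum, map_smul, hgr, Finset.sum_smul, Submodule.coe_sum, Submodule.coe_smul, hMapply,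
      map_sum, map_smul, Finset.smul_sum, smul_smul]
    rw [Finset.sum_comm]
    refine Finset.sum_congr rfl fun k _ ↦ ?_
    rw [Finset.sum_comm]
    exact Finset.sum_congr rfl fun j _ ↦ Finset.sum_congr rfl fun α _ ↦ by rw [mul_comm]
  refine ⟨l, fun b₀ π hpπ hπp hππ ↦ ?_⟩
  have hπW : ∀ v, π v ∈ W b₀ := fun v ↦ ⟨π v, by rw [← Module.End.mul_apply, hpπ]⟩
  -- `Π_π = Σᵢ x_{b₀i} π y_{b₀i}` on the transplants: `Π_π M_{bα} w = δ_{b b₀} M_{b₀α} (π w)`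
  have hRM : ∀ b α (w : V), w ∈ W b →
      (∑ i, x b₀ i * π * y b₀ i) (M b α w) = if b = b₀ then M b α (π w) else 0 := by
    intro b α w hw
    rw [LinearMap.sum_apply]
    simp_rw [Module.End.mul_apply]
    split_ifs with hb
    · subst hb
      rw [hMapply b α (π w)]
      exact Finset.sum_congr rfl fun i _ ↦ by rw [hyM, map_smul, map_smul, hpW _ w hw]
    · exact Finset.sum_eq_zero fun i _ ↦ by rw [hyM' b₀ b (Ne.symm hb), map_zero, map_zero]
  have hRR := sum_mul_corner_mul_mul_self hxy hpπ hππ (x := x) (y := y)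
  -- `Θ₁ : (πW_{b₀})^{l_{b₀}} → V`, `g ↦ Σ_α M_{b₀α} (g α)`
  let Θ₁ : (Fin (l b₀) → LinearMap.range π) →ₗ[K] V :=
    ∑ α, (M b₀ α ∘ₗ (LinearMap.range π).subtype) ∘ₗ LinearMap.proj α
  have hΘ₁ : ∀ g, Θ₁ g = ∑ α, M b₀ α (g α) := fun g ↦ by
    simp only [Θ₁, LinearMap.sum_apply, LinearMap.comp_apply, LinearMap.proj_apply, Submodule.subtype_apply]
  have hπr : ∀ g : LinearMap.range π, (g : V) ∈ W b₀ := fun g ↦ by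
    obtain ⟨v, hv⟩ := g.2
    rw [← hv]
    exact hπW v
  have hπfix : ∀ g : LinearMap.range π, π (g : V) = g := fun g ↦ by
    obtain ⟨v, hv⟩ := g.2
    rw [← hv, ← Module.End.mul_apply, hππ]
  have hΘ₁inj : Function.Injective Θ₁ := by
    rw [← LinearMap.ker_eq_bot, LinearMap.ker_eq_bot']
    intro g hg
    have hcoord : ∀ k, ∑ α, ξ b₀ α k • (g α : V) = 0 := fun k ↦ by
      have h := congrArg (y b₀ k) hg
      rw [hΘ₁, map_sum, map_zero] at h
      rw [← h]
      exact Finset.sum_congr rfl fun α _ ↦ by rw [hyM, hpW b₀ _ (hπr (g α))]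
    have h0 := hsep₁ b₀ (fun α ↦ ⟨g α, hπr (g α)⟩) hcoord
    funext α
    apply Subtype.ext
    have h1 := congrArg (fun f : Fin (l b₀) → W b₀ ↦ ((f α : W b₀) : V)) h0
    simpa using h1
  have hrange : LinearMap.range Θ₁ = Vτ ⊓ LinearMap.range (∑ i, x b₀ i * π * y b₀ i) := by
    refine le_antisymm ?_ ?_
    · rintro _ ⟨g, rfl⟩
      rw [hΘ₁]
      refine ⟨Submodule.sum_mem _ fun α _ ↦ hMV b₀ α _ (hπr (g α)), Submodule.sum_mem _ fun α _ ↦ ?_⟩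
      exact ⟨M b₀ α (g α), by rw [hRM b₀ α _ (hπr (g α)), if_pos rfl, hπfix]⟩
    · rintro v ⟨hv, ⟨v', hv'⟩⟩
      have hRv : (∑ i, x b₀ i * π * y b₀ i) v = v := by rw [← hv', ← Module.End.mul_apply, hRR]
      obtain ⟨f, hf⟩ := hΘsurj ⟨v, hv⟩
      have hfv : (Θ f : V) = v := congrArg Subtype.val hf
      refine ⟨fun α ↦ ⟨π (f ⟨b₀, α⟩ : V), ⟨_, rfl⟩⟩, ?_⟩
      rw [hΘ₁, ← hRv, ← hfv, hΘ', map_sum, Finset.sum_eq_single b₀]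
      · rw [map_sum]
        exact Finset.sum_congr rfl fun α _ ↦ by rw [hRM b₀ α _ (f ⟨b₀, α⟩).2, if_pos rfl]
      · intro b _ hb
        rw [map_sum]
        exact Finset.sum_eq_zero fun α _ ↦ by rw [hRM b α _ (f ⟨b, α⟩).2, if_neg hb]
      · exact fun hb ↦ absurd (Finset.mem_univ b₀) hb
  rw [← hrange, LinearMap.finrank_range_of_inj hΘ₁inj, Module.finrank_pi_fintype, Finset.sum_const,
    Finset.card_univ, Fintype.card_fin, smul_eq_mul]

end Blocks

section RankOne

variable {K V : Type*} [Field K] [AddCommGroup V] [Module K V]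

/-- **A NON-ZERO ORTHOGONAL CORNER CONTAINS A RANK-ONE ORTHOGONAL IDEMPOTENT** (`char K ≠ 2`): if `β(v, w) = Φ(v, s w)` is
symmetric on `W = pV` (`p² = p ≠ 0`) and non-degenerate on `W`, there is `π` with `pπ = πp = π = π²`, `dim πV = 1` and
`β(π v, w) = β(v, π w)` on `W` — the `β`-orthogonal projection onto a non-isotropic line `K w₀` (one exists, `β` being
symmetric and non-zero: polarization), `π v = β(p v, w₀)/β(w₀, w₀) · w₀`.
[cite: HornJohnson2013, §0.8–§0.9 and §4.5 (congruence, non-isotropic vectors of a symmetric form)] -/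
theorem exists_rankOne_corner_idempotent_selfAdjoint (h2 : (2 : K) ≠ 0) (Φ : V →ₗ[K] V →ₗ[K] K)
    {p s : Module.End K V} (hp : p * p = p) (hp0 : p ≠ 0)
    (hsymm : ∀ v ∈ LinearMap.range p, ∀ w ∈ LinearMap.range p, Φ v (s w) = Φ w (s v))
    (hnd : ∀ v ∈ LinearMap.range p, (∀ w ∈ LinearMap.range p, Φ v (s w) = 0) → v = 0) :
    ∃ π : Module.End K V, p * π = π ∧ π * p = π ∧ π * π = π ∧ Module.finrank K (LinearMap.range π) = 1 ∧
      ∀ v ∈ LinearMap.range p, ∀ w ∈ LinearMap.range p, Φ (π v) (s w) = Φ v (s (π w)) := by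
  -- a non-isotropic vector of `W`
  obtain ⟨w₀, hw₀W, hw₀⟩ : ∃ w₀ ∈ LinearMap.range p, Φ w₀ (s w₀) ≠ 0 := by
    by_contra hall
    push Not at hall
    have hzero : ∀ v ∈ LinearMap.range p, ∀ w ∈ LinearMap.range p, Φ v (s w) = 0 := by
      intro v hv w hw
      have h1 := hall (v + w) (add_mem hv hw)
      simp only [map_add, LinearMap.add_apply] at h1
      rw [hall v hv, hall w hw, hsymm w hw v hv, zero_add, add_zero, ← two_mul] at h1
      exact (mul_eq_zero.1 h1).resolve_left h2
    exact hp0 (LinearMap.ext fun v ↦ hnd _ ⟨v, rfl⟩ fun w hw ↦ hzero _ ⟨v, rfl⟩ w hw)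
  have hpW : ∀ v ∈ LinearMap.range p, p v = v := by
    rintro _ ⟨v, rfl⟩
    rw [← Module.End.mul_apply, hp]
  set c := Φ w₀ (s w₀) with hcdef
  let f : V →ₗ[K] K := c⁻¹ • ((Φ.flip (s w₀)) ∘ₗ p)
  have hf : ∀ v, f v = c⁻¹ * Φ (p v) (s w₀) := fun v ↦ rfl
  let π : Module.End K V := f.smulRight w₀
  have hπ : ∀ v, π v = f v • w₀ := fun v ↦ rfl
  have hfw₀ : f w₀ = 1 := by rw [hf, hpW w₀ hw₀W, inv_mul_cancel₀ hw₀]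
  have hw₀ne : w₀ ≠ 0 := by
    rintro rfl
    exact hw₀ (by rw [hcdef, map_zero, LinearMap.zero_apply])
  refine ⟨π, ?_, ?_, ?_, ?_, ?_⟩
  · exact LinearMap.ext fun v ↦ by rw [Module.End.mul_apply, hπ, map_smul, hpW w₀ hw₀W]
  · exact LinearMap.ext fun v ↦ by rw [Module.End.mul_apply, hπ, hπ, hf, hf, ← Module.End.mul_apply p p, hp]
  · exact LinearMap.ext fun v ↦ by rw [Module.End.mul_apply, hπ, hπ, map_smul, hfw₀, smul_eq_mul, mul_one]
  · have hrange : LinearMap.range π = K ∙ w₀ := by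
      refine le_antisymm ?_ ?_
      · rintro _ ⟨v, rfl⟩
        rw [hπ]
        exact Submodule.smul_mem _ _ (Submodule.mem_span_singleton_self w₀)
      · rw [Submodule.span_singleton_le_iff_mem]
        exact ⟨w₀, by rw [hπ, hfw₀, one_smul]⟩
    rw [hrange, finrank_span_singleton hw₀ne]
  · intro v hv w hw
    rw [hπ, hπ, map_smul, LinearMap.smul_apply, map_smul, map_smul, smul_eq_mul, smul_eq_mul, hf, hf, hpW v hv,
      hpW w hw, hsymm w₀ hw₀W w hw]
    ring

end RankOne

end Literature.LinearAlgebra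

/-! ### §2 The carrier `H¹(A(ℂ); ℂ)`: reflections in `S(A)(h)(ℂ)`, the general exceptionality criterion, and «ODD
EXPONENT ⟹ `W_F` EXCEPTIONAL» for orthogonal corners exhausting the pull-back algebra -/

namespace Literature.AlgebraicGeometry.HodgeTheory

open CategoryTheory
open Literature.AlgebraicGeometry.Motives
open Literature.AlgebraicGeometry.VanGeemen1994 (hodgeClassSpan pullbackOne detOnEigenspace mapsTo_eigenspace_of_comm)
open Literature.AlgebraicGeometry.Milne1999 (exists_injective_linearMap_topDegree centralizerGroup unitaryCentralizerGroup)
open Literature.AlgebraicTopology.SingularHomology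
open Literature.Barriers.HodgeConjecture (divisorClassesSpan)
open Literature.LinearAlgebra

section Reflection

variable {A : AbelianVariety ℂ} {h : complexBetti A.X 2} {φ : A ⟶ A} {P : Polynomial ℤ} {e m : ℕ}

/-- **THE REFLECTION OF A SELF-ADJOINT IDEMPOTENT OF THE COMMUTANT LIES IN `S(A)(h)(ℂ)` AND HAS
`det = (-1)^{rank}` ON EVERY EIGENSPACE.**  If `R` is an idempotent of `End(H¹(A(ℂ); ℂ))` commuting with every pull-back
`χ^*` and `Q_h`-self-adjoint, then `g = 1 - 2R` (`g² = 1`) is an element of `S(A)(h)(ℂ) = unitaryCentralizerGroup A h`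
with `det(g | V_τ) = (-1)^{dim(V_τ ∩ RV)}` on every eigenspace `V_τ = ker(φ^* - τ)` of every `φ ∈ End(A)`.  In the
print: «an element `g ∈ G_div^{(τ)}(ℂ)` which is not in the connected component … `Nrd_ℂ(g) = det_ℂ(g) = -1`» — a
reflection of `(Stand, symmetric form)` for `G_div^{(τ)} ≅ O_{2k}`, tensored with the identity of `W^{(τ)}`.
[cite: MoonenZarhin1998WeilClasses, §1 proof of Criterion (2), case «type 3 with m ≥ 2» (chunk p0003 L92–L111)]
[cite: Milne1999LefschetzClasses, §1 p. 644 (definition of S(A))] [cite: HornJohnson2013, §0.9.2, §2.1] -/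
theorem exists_mem_unitaryCentralizerGroup_coe_eq_one_sub_two_smul {R : Module.End ℂ (complexBetti A.X 1)}
    (hR : IsIdempotentElem R) (hRc : ∀ (χ : A ⟶ A) (v : complexBetti A.X 1), R (pullbackOne A χ v) = pullbackOne A χ (R v))
    (hRadj : ∀ v w : complexBetti A.X 1,
      polarizationPairingOne A.X h (A.dim - 1) (R v) w = polarizationPairingOne A.X h (A.dim - 1) v (R w)) :
    ∃ (u : complexBetti A.X 1 ≃ₗ[ℂ] complexBetti A.X 1) (hu : u ∈ unitaryCentralizerGroup A h),
      (u : complexBetti A.X 1 →ₗ[ℂ] complexBetti A.X 1) = 1 - (2 : ℂ) • R ∧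
      ∀ τ : ℂ, detOnEigenspace u (pullbackOne A φ) (hu.1 φ) τ =
        (-1) ^ Module.finrank ℂ ↥((pullbackOne A φ).eigenspace τ ⊓ LinearMap.range R) := by
  haveI : Module.Finite ℂ (complexBetti A.X 1) := abelianVarietyCohomologyExteriorH1_holds.finite_one A
  have hRR : ∀ v, R (R v) = R v := fun v ↦ by rw [← Module.End.mul_apply, hR.eq]
  set g : Module.End ℂ (complexBetti A.X 1) := 1 - (2 : ℂ) • R with hgdef
  have hg : ∀ v, g v = v - (2 : ℂ) • R v := fun v ↦ by
    rw [hgdef, LinearMap.sub_apply, Module.End.one_apply, LinearMap.smul_apply]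
  have hgg : ∀ v, g (g v) = v := fun v ↦ by
    rw [hg, hg, map_sub, map_smul, hRR]
    module
  let u : complexBetti A.X 1 ≃ₗ[ℂ] complexBetti A.X 1 :=
    { g with invFun := g, left_inv := hgg, right_inv := hgg }
  have hu_apply : ∀ v, u v = g v := fun _ ↦ rfl
  have huc : u ∈ centralizerGroup A := by
    intro χ v
    rw [hu_apply, hu_apply, hg, hg, map_sub, map_smul, hRc]
  have huQ : ∀ v w : complexBetti A.X 1, polarizationPairingOne A.X h (A.dim - 1) (u v) (u w) =
      polarizationPairingOne A.X h (A.dim - 1) v w := by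
    intro v w
    rw [hu_apply, hu_apply, hg, hg]
    simp only [map_sub, map_smul, LinearMap.sub_apply, LinearMap.smul_apply, hRadj, hRR]
    module
  have hu : u ∈ unitaryCentralizerGroup A h := ⟨huc, huQ⟩
  refine ⟨u, hu, rfl, fun τ ↦ ?_⟩
  have hmaps : Set.MapsTo R ((pullbackOne A φ).eigenspace τ) ((pullbackOne A φ).eigenspace τ) := by
    intro v hv
    rw [SetLike.mem_coe, Module.End.mem_eigenspace_iff] at hv ⊢
    rw [← hRc φ v, hv, map_smul]
  exact det_restrict_one_sub_two_smul_of_isIdempotentElem hR hmaps _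

/-- **THE EXCEPTIONALITY CRITERION BY A REFLECTION — a `Q_h`-self-adjoint idempotent of the commutant with ODD rank on
some `V_ρ` makes all non-zero Weil classes of `F` exceptional.**  For `P ∈ ℤ[T]` monic irreducible of degree `e`,
`P(φ) = 0`, `e · 2m = 2 dim A`, `m ≠ 0`, `h ∈ B¹ ⊗ ℂ` with `Q_h` non-degenerate: if an idempotent `R` commuting with every
`χ^*` and `Q_h`-self-adjoint has `dim(V_ρ ∩ RV)` odd at some complex root `ρ` of `P`, then `W_F ⊗ ℂ ⊓ 𝒟ᵐ ⊗ ℂ = ⊥`: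
the reflection `1 - 2R ∈ S(A)(h)(ℂ)` has `det = -1` on `V_ρ`, and the tree's
`weilClassesField_inf_divisorClassesSpan_eq_bot_iff_exists_detOnEigenspace_ne_one` applies.  «It then follows … that `g`
acts on `W_F ⊗ ℂ` as multiplication by `(-1)^{2m/[F:E]}`, which proves the assertion» — here the exponent is
`dim(V_ρ ∩ RV)`. [cite: MoonenZarhin1998WeilClasses, §1 Criterion (2) («all non-zero classes in W_F are exceptional … Y is of Type 3, m ≥ 2 and the integer 2m·[E:ℚ]/[F:ℚ] is odd») and its proof (chunk p0003 L46–L60, L92–L111)]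
[cite: Milne1999LefschetzClasses, §1 p. 644, Thm. 3.2, Cor. 4.5] -/
theorem weilClassesField_inf_divisorClassesSpan_eq_bot_of_isIdempotentElem_of_odd (hPm : P.Monic)
    (hPe : P.natDegree = e) (hPirr : Irreducible (P.map (Int.castRingHom ℚ)))
    (hφ : Polynomial.eval₂ (Int.castRingHom (CategoryTheory.End A)) (φ : CategoryTheory.End A) P = 0)
    (her : e * (2 * m) = 2 * A.dim) (hm : m ≠ 0) (hh : h ∈ hodgeClassSpan A.dim A.X 1)
    (hnd : ∀ v : complexBetti A.X 1, (∀ w, polarizationPairingOne A.X h (A.dim - 1) v w = 0) → v = 0)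
    {R : Module.End ℂ (complexBetti A.X 1)} (hR : IsIdempotentElem R)
    (hRc : ∀ (χ : A ⟶ A) (v : complexBetti A.X 1), R (pullbackOne A χ v) = pullbackOne A χ (R v))
    (hRadj : ∀ v w : complexBetti A.X 1,
      polarizationPairingOne A.X h (A.dim - 1) (R v) w = polarizationPairingOne A.X h (A.dim - 1) v (R w))
    (hodd : ∃ ρ : ℂ, Polynomial.eval₂ (Int.castRingHom ℂ) ρ P = 0 ∧
      Odd (Module.finrank ℂ ↥((pullbackOne A φ).eigenspace ρ ⊓ LinearMap.range R))) :
    weilClassesField A φ P (2 * m) ⊓ divisorClassesSpan A.X A.dim m = ⊥ := by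
  obtain ⟨ρ, hρ, hodd⟩ := hodd
  obtain ⟨u, hu, -, hdet⟩ := exists_mem_unitaryCentralizerGroup_coe_eq_one_sub_two_smul (φ := φ) hR hRc hRadj
  refine (weilClassesField_inf_divisorClassesSpan_eq_bot_iff_exists_detOnEigenspace_ne_one hPm hPe hPirr hφ her hm hh
    hnd).2 ⟨u, hu, ρ, hρ, ?_⟩
  rw [hdet ρ, hodd.neg_one_pow]
  norm_num

end Reflection

section Blocks

variable {A : AbelianVariety ℂ} {h : complexBetti A.X 2} {φ : A ⟶ A} {P : Polynomial ℤ} {e m : ℕ}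
  {κ ι : Type*} [Fintype κ] [DecidableEq κ] [Fintype ι] [DecidableEq ι]
  {x y : κ → ι → Module.End ℂ (complexBetti A.X 1)} {p s : κ → Module.End ℂ (complexBetti A.X 1)}
  {b₀ : κ} {π : Module.End ℂ (complexBetti A.X 1)} {σ : ι → ι} {ε : ι → ℂ}

/-- **THE REFLECTION OF A SUB-CORNER — ODD RANK ⟹ EXCEPTIONAL.**  Let `x, y, p` be a system of matrix blocks on
`H¹(A(ℂ); ℂ)` whose units SPAN A SPACE CONTAINING EVERY PULL-BACK `χ^*`, `χ ∈ End(A)` («`End⁰(X) = M_m(D)`», so that the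
commutant of the units is inside Milne's `C(A)`); let the block `b₀` carry the type-3 adjoint structure for `Q_h`
(`Q_h(x_{b₀k} v, w) = ε_k Q_h(v, s_{b₀} y_{b₀σ(k)} w)`, `σ` an involution, `ε_{σ k} = -ε_k`, `β(v, w) = Q_h(v, s_{b₀} w)`
symmetric on `W_{b₀}`), and let `π` be a `β`-self-adjoint idempotent of the corner `W_{b₀}` (`p_{b₀} π = π p_{b₀} = π = π²`).
If `dim(V_ρ ∩ Π_π V)` is ODD at some complex root `ρ` of `P` (`Π_π = Σₖ x_{b₀k} π y_{b₀k}`), then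
`W_F ⊗ ℂ ⊓ 𝒟ᵐ ⊗ ℂ = ⊥` (`m ≠ 0`, `Q_h` non-degenerate): `1 - 2Π_π ∈ S(A)(h)(ℂ)` is the print's `g` with `det_ℂ(g) = -1`.
[cite: MoonenZarhin1998WeilClasses, §1 Criterion (2) and its proof, case «type 3 with m ≥ 2» (chunk p0003 L46–L60, L92–L111)]
[cite: Milne1999LefschetzClasses, §1 pp. 642–644, Thm. 3.2, Cor. 4.5] [cite: McconnellRobson2001, 3.5.5–3.5.7] -/
theorem weilClassesField_inf_divisorClassesSpan_eq_bot_of_matrixBlocks_of_cornerIdempotent_of_odd (hPm : P.Monic)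
    (hPe : P.natDegree = e) (hPirr : Irreducible (P.map (Int.castRingHom ℚ)))
    (hφ : Polynomial.eval₂ (Int.castRingHom (CategoryTheory.End A)) (φ : CategoryTheory.End A) P = 0)
    (her : e * (2 * m) = 2 * A.dim) (hm : m ≠ 0) (hh : h ∈ hodgeClassSpan A.dim A.X 1)
    (hnd : ∀ v : complexBetti A.X 1, (∀ w, polarizationPairingOne A.X h (A.dim - 1) v w = 0) → v = 0)
    (hxy : ∀ b i j, y b i * x b j = if i = j then p b else 0)
    (hcross : ∀ b b', b ≠ b' → ∀ i j, y b i * x b' j = 0) (hsum : ∑ b, ∑ i, x b i * y b i = 1)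
    (hEnd : ∀ χ : A ⟶ A, pullbackOne A χ ∈ Submodule.span ℂ (Set.range fun t : κ × ι × ι ↦ x t.1 t.2.1 * y t.1 t.2.2))
    (hsymm : ∀ v ∈ LinearMap.range (p b₀), ∀ w ∈ LinearMap.range (p b₀),
      polarizationPairingOne A.X h (A.dim - 1) v (s b₀ w) = polarizationPairingOne A.X h (A.dim - 1) w (s b₀ v))
    (hadj : ∀ k (v w : complexBetti A.X 1), polarizationPairingOne A.X h (A.dim - 1) (x b₀ k v) w =
      ε k • polarizationPairingOne A.X h (A.dim - 1) v (s b₀ (y b₀ (σ k) w)))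
    (hσ : Function.Involutive σ) (hε : ∀ k, ε (σ k) = -ε k)
    (hpπ : p b₀ * π = π) (hπp : π * p b₀ = π) (hππ : π * π = π)
    (hπβ : ∀ v ∈ LinearMap.range (p b₀), ∀ w ∈ LinearMap.range (p b₀),
      polarizationPairingOne A.X h (A.dim - 1) (π v) (s b₀ w) = polarizationPairingOne A.X h (A.dim - 1) v (s b₀ (π w)))
    (hodd : ∃ ρ : ℂ, Polynomial.eval₂ (Int.castRingHom ℂ) ρ P = 0 ∧
      Odd (Module.finrank ℂ ↥((pullbackOne A φ).eigenspace ρ ⊓ LinearMap.range (∑ k, x b₀ k * π * y b₀ k)))) :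
    weilClassesField A φ P (2 * m) ⊓ divisorClassesSpan A.X A.dim m = ⊥ := by
  have hpy : ∀ b i, p b * y b i = y b i := idem_mul_of_matrixBlocks hxy hcross hsum
  refine weilClassesField_inf_divisorClassesSpan_eq_bot_of_isIdempotentElem_of_odd hPm hPe hPirr hφ her hm hh hnd
    (sum_mul_corner_mul_mul_self hxy hpπ hππ) (fun χ v ↦ ?_)
    (bilin_sum_mul_corner_mul_comm (polarizationPairingOne A.X h (A.dim - 1))
      (fun v w ↦ polarizationPairingOne_swap h (A.dim - 1) w v) hpπ (hpy b₀) hsymm hadj hσ hε hπβ) hodd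
  have hc := mul_comm_of_mem_span_units
    (fun b i j ↦ sum_mul_corner_mul_comm_unit hxy hcross hpπ hπp b i j) (hEnd χ)
  have e1 := LinearMap.congr_fun hc v
  rw [Module.End.mul_apply, Module.End.mul_apply] at e1
  exact e1

/-- **ODD EXPONENT ⟹ `W_F ⊗ ℂ ⊓ 𝒟ᵐ ⊗ ℂ = ⊥` (MOONEN–ZARHIN's CRITERION (2), TYPE 3 WITH `m ≥ 2`, THE EXCEPTIONAL
ALTERNATIVE ON THE CARRIER).**  Let `x, y, p` be a system of matrix blocks on `H¹(A(ℂ); ℂ)` whose units span a space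
containing every pull-back, and let the block `b₀` have an ORTHOGONAL CORNER with its adjoint structure: an operator
`s_{b₀}` with `β(v, w) = Q_h(v, s_{b₀} w)` symmetric and non-degenerate on `W_{b₀} = p_{b₀}V ≠ 0`, and
`Q_h(x_{b₀k} v, w) = ε_k Q_h(v, s_{b₀} y_{b₀σ(k)} w)` (`σ` an involution of `ι`, `ε_{σk} = -ε_k`).  IF at some complex
root `ρ` of `P` the exponent `l_{b₀}(ρ) = dim(V_ρ ∩ Q_{b₀}V)/dim W_{b₀}` is ODD, THEN all non-zero Weil classes of
`F = ℚ(φ)` are exceptional: `W_F ⊗ ℂ ⊓ 𝒟ᵐ ⊗ ℂ = ⊥`.  Proof: a rank-one `β`-orthogonal idempotent `π` of `W_{b₀}`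
(§1, non-isotropic vector) gives `Π_π` with `dim(V_ρ ∩ Π_π V) = l_{b₀}(ρ)` (§1, the Morita rank identity), and the
reflection `1 - 2Π_π ∈ S(A)(h)(ℂ)` has determinant `(-1)^{l_{b₀}(ρ)} = -1` on `V_ρ`.  The print, case `E ⊆ F`:
«`W_F` consists of decomposable classes if and only if `2m/[F:E]` is even»; here the exponent is read place by place
(`b₀ = τ`), cf. the module docstring of `WeilClassesFieldOrthogonalCornersParity`.
[cite: MoonenZarhin1998WeilClasses, §1 Criterion (2) («Y is of Type 3, m ≥ 2 and the integer 2m·[E:ℚ]/[F:ℚ] is odd») and its proof (chunk p0003 L46–L60, L92–L111; p0004 L1–L27)]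
[cite: Milne1999LefschetzClasses, §1 pp. 642–644, Thm. 3.2, Cor. 4.5] [cite: McconnellRobson2001, 3.5.5–3.5.7] -/
theorem weilClassesField_inf_divisorClassesSpan_eq_bot_of_cornerForms_of_odd (hPm : P.Monic)
    (hPe : P.natDegree = e) (hPirr : Irreducible (P.map (Int.castRingHom ℚ)))
    (hφ : Polynomial.eval₂ (Int.castRingHom (CategoryTheory.End A)) (φ : CategoryTheory.End A) P = 0)
    (her : e * (2 * m) = 2 * A.dim) (hm : m ≠ 0) (hh : h ∈ hodgeClassSpan A.dim A.X 1)
    (hnd : ∀ v : complexBetti A.X 1, (∀ w, polarizationPairingOne A.X h (A.dim - 1) v w = 0) → v = 0)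
    (hxy : ∀ b i j, y b i * x b j = if i = j then p b else 0)
    (hcross : ∀ b b', b ≠ b' → ∀ i j, y b i * x b' j = 0) (hsum : ∑ b, ∑ i, x b i * y b i = 1)
    (hEnd : ∀ χ : A ⟶ A, pullbackOne A χ ∈ Submodule.span ℂ (Set.range fun t : κ × ι × ι ↦ x t.1 t.2.1 * y t.1 t.2.2))
    (hsymm : ∀ v ∈ LinearMap.range (p b₀), ∀ w ∈ LinearMap.range (p b₀),
      polarizationPairingOne A.X h (A.dim - 1) v (s b₀ w) = polarizationPairingOne A.X h (A.dim - 1) w (s b₀ v))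
    (hnds : ∀ v ∈ LinearMap.range (p b₀),
      (∀ w ∈ LinearMap.range (p b₀), polarizationPairingOne A.X h (A.dim - 1) v (s b₀ w) = 0) → v = 0)
    (hadj : ∀ k (v w : complexBetti A.X 1), polarizationPairingOne A.X h (A.dim - 1) (x b₀ k v) w =
      ε k • polarizationPairingOne A.X h (A.dim - 1) v (s b₀ (y b₀ (σ k) w)))
    (hσ : Function.Involutive σ) (hε : ∀ k, ε (σ k) = -ε k) (hp0 : p b₀ ≠ 0)
    (hodd : ∃ ρ : ℂ, Polynomial.eval₂ (Int.castRingHom ℂ) ρ P = 0 ∧ ∃ j : ℕ,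
      Module.finrank ℂ ↥((pullbackOne A φ).eigenspace ρ ⊓ LinearMap.range (∑ i, x b₀ i * y b₀ i)) =
        (2 * j + 1) * Module.finrank ℂ (LinearMap.range (p b₀))) :
    weilClassesField A φ P (2 * m) ⊓ divisorClassesSpan A.X A.dim m = ⊥ := by
  classical
  haveI : Module.Finite ℂ (complexBetti A.X 1) := abelianVarietyCohomologyExteriorH1_holds.finite_one A
  obtain ⟨ℓ, hℓ⟩ := exists_injective_linearMap_topDegree A
  set Φ : LinearMap.BilinForm ℂ (complexBetti A.X 1) :=
    (polarizationPairingOne A.X h (A.dim - 1)).compr₂ ℓ with hΦdef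
  have hΦapply : ∀ v w, Φ v w = ℓ (polarizationPairingOne A.X h (A.dim - 1) v w) := fun _ _ ↦ rfl
  have hxp : ∀ b i, x b i * p b = x b i := mul_idem_of_matrixBlocks hxy hcross hsum
  have hpp : ∀ b, p b * p b = p b := idem_of_matrixBlocks hxy hsum hxp
  -- a rank-one `β`-orthogonal idempotent of `W_{b₀}`
  obtain ⟨π, hpπ, hπp, hππ, hrank, hπβ⟩ := exists_rankOne_corner_idempotent_selfAdjoint two_ne_zero Φ (hpp b₀) hp0
    (fun v hv w hw ↦ by rw [hΦapply, hΦapply, hsymm v hv w hw])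
    (fun v hv h0 ↦ hnds v hv fun w hw ↦ hℓ (by rw [← hΦapply, h0 w hw, map_zero]))
  -- the Morita rank identity: `dim(V_ρ ∩ Π_π V) = l_{b₀}(ρ) = dim(V_ρ ∩ Q_{b₀} V)/dim W_{b₀}`
  obtain ⟨ρ, hρ, j, hj⟩ := hodd
  obtain ⟨c, hcφ⟩ := exists_eq_sum_smul_of_mem_span_units_blocks (hEnd φ)
  obtain ⟨l, hl⟩ := exists_forall_finrank_eigenspace_inf_range_corner_eq hxy hcross hsum c hcφ ρ
  have h1 := hl b₀ π hpπ hπp hππ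
  have h2 := hl b₀ (p b₀) (hpp b₀) (hpp b₀) (hpp b₀)
  have hQ : ∑ i, x b₀ i * p b₀ * y b₀ i = ∑ i, x b₀ i * y b₀ i := Finset.sum_congr rfl fun i _ ↦ by rw [hxp]
  rw [hQ, hj] at h2
  have hd : Module.finrank ℂ (LinearMap.range (p b₀)) ≠ 0 := by
    intro h0
    exact hp0 (LinearMap.range_eq_bot.1 (Submodule.finrank_eq_zero.1 h0))
  have hlb : l b₀ = 2 * j + 1 := (Nat.eq_of_mul_eq_mul_right (Nat.pos_of_ne_zero hd) h2).symm
  rw [hrank, mul_one, hlb] at h1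
  refine weilClassesField_inf_divisorClassesSpan_eq_bot_of_matrixBlocks_of_cornerIdempotent_of_odd hPm hPe hPirr hφ her
    hm hh hnd hxy hcross hsum hEnd hsymm hadj hσ hε hpπ hπp hππ (fun v hv w hw ↦ hℓ ?_) ⟨ρ, hρ, ?_⟩
  · rw [← hΦapply, ← hΦapply, hπβ v hv w hw]
  · rw [h1]
    exact odd_two_mul_add_one j

/-- **THE DICHOTOMY, DECOMPOSABLE SIDE: `W_F ⊗ ℂ ≤ 𝒟ᵐ ⊗ ℂ` IFF EVERY EXPONENT `l_b(ρ)` IS EVEN.**  For a system of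
matrix blocks inside the pull-back algebra whose units span a space containing every pull-back, with orthogonal corners
and their adjoint structure at EVERY block (`m ≠ 0`, `Q_h` non-degenerate): `W_F ⊗ ℂ ≤ 𝒟ᵐ ⊗ ℂ` iff for every complex
root `ρ` of `P` and every block `b`, `dim(V_ρ ∩ Q_b V)` is an even multiple of `dim W_b` («⟸» is the seat's
`weilClassesField_le_divisorClassesSpan_of_cornerForms_of_even`; «⟹»: an odd exponent makes `W_F` exceptional by
`weilClassesField_inf_divisorClassesSpan_eq_bot_of_cornerForms_of_odd`, and `W_F ≠ 0`).  The print: «either all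
classes in `W_F` are decomposable, or all non-zero classes in `W_F` are exceptional; this last possibility occurs
precisely in the following cases: … `Y` is of Type 3, `m ≥ 2` and the integer `2m · [E:ℚ]/[F:ℚ]` is odd».
[cite: MoonenZarhin1998WeilClasses, §1 Criterion (2) and its proof, type 3 (chunk p0003 L46–L60, L92–L111; p0004 L1–L27)]
[cite: Milne1999LefschetzClasses, §1 pp. 642–644, Thm. 3.2, Cor. 4.5] [cite: McconnellRobson2001, 3.5.5–3.5.7] -/
theorem weilClassesField_le_divisorClassesSpan_iff_forall_even_of_cornerForms (hPm : P.Monic)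
    (hPe : P.natDegree = e) (hPirr : Irreducible (P.map (Int.castRingHom ℚ)))
    (hφ : Polynomial.eval₂ (Int.castRingHom (CategoryTheory.End A)) (φ : CategoryTheory.End A) P = 0)
    (her : e * (2 * m) = 2 * A.dim) (hm : m ≠ 0) (hh : h ∈ hodgeClassSpan A.dim A.X 1)
    (hnd : ∀ v : complexBetti A.X 1, (∀ w, polarizationPairingOne A.X h (A.dim - 1) v w = 0) → v = 0)
    (hxy : ∀ b i j, y b i * x b j = if i = j then p b else 0)
    (hcross : ∀ b b', b ≠ b' → ∀ i j, y b i * x b' j = 0) (hsum : ∑ b, ∑ i, x b i * y b i = 1)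
    (hx : ∀ b i, x b i ∈ Algebra.adjoin ℂ (Set.range fun χ : A ⟶ A ↦ pullbackOne A χ))
    (hy : ∀ b i, y b i ∈ Algebra.adjoin ℂ (Set.range fun χ : A ⟶ A ↦ pullbackOne A χ))
    (hs : ∀ b, s b ∈ Algebra.adjoin ℂ (Set.range fun χ : A ⟶ A ↦ pullbackOne A χ))
    (hEnd : ∀ χ : A ⟶ A, pullbackOne A χ ∈ Submodule.span ℂ (Set.range fun t : κ × ι × ι ↦ x t.1 t.2.1 * y t.1 t.2.2))
    (hsymm : ∀ b, ∀ v ∈ LinearMap.range (p b), ∀ w ∈ LinearMap.range (p b),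
      polarizationPairingOne A.X h (A.dim - 1) v (s b w) = polarizationPairingOne A.X h (A.dim - 1) w (s b v))
    (hnds : ∀ b, ∀ v ∈ LinearMap.range (p b),
      (∀ w ∈ LinearMap.range (p b), polarizationPairingOne A.X h (A.dim - 1) v (s b w) = 0) → v = 0)
    (hadj : ∀ b k (v w : complexBetti A.X 1), polarizationPairingOne A.X h (A.dim - 1) (x b k v) w =
      ε k • polarizationPairingOne A.X h (A.dim - 1) v (s b (y b (σ k) w)))
    (hσ : Function.Involutive σ) (hε : ∀ k, ε (σ k) = -ε k) :
    weilClassesField A φ P (2 * m) ≤ divisorClassesSpan A.X A.dim m ↔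
      ∀ ρ : ℂ, Polynomial.eval₂ (Int.castRingHom ℂ) ρ P = 0 → ∀ b, ∃ j : ℕ,
        Module.finrank ℂ ↥((pullbackOne A φ).eigenspace ρ ⊓ LinearMap.range (∑ i, x b i * y b i)) =
          2 * j * Module.finrank ℂ (LinearMap.range (p b)) := by
  classical
  refine ⟨fun hle ρ hρ b ↦ ?_, fun heven ↦ weilClassesField_le_divisorClassesSpan_of_cornerForms_of_even hPm hPe hPirr
    hφ her hh hnd hxy hcross hsum hsymm hnds hx hy hs (hEnd φ) heven⟩
  by_contra hne
  haveI : Module.Finite ℂ (complexBetti A.X 1) := abelianVarietyCohomologyExteriorH1_holds.finite_one A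
  obtain ⟨c, hcφ⟩ := exists_eq_sum_smul_of_mem_span_units_blocks (hEnd φ)
  obtain ⟨l, hl, -⟩ := exists_forall_det_restrict_eigenspace_eq_prod_pow hxy hcross hsum c hcφ ρ
  obtain ⟨j, hj | hj⟩ := Nat.even_or_odd' (l b)
  · exact hne ⟨j, by rw [← hl b, hj]⟩
  · have hp0 : p b ≠ 0 := by
      intro h0
      apply hne
      refine ⟨0, ?_⟩
      rw [← hl b, h0, LinearMap.range_zero, finrank_bot, mul_zero, mul_zero]
    have hbot := weilClassesField_inf_divisorClassesSpan_eq_bot_of_cornerForms_of_odd (b₀ := b) hPm hPe hPirr hφ her hm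
      hh hnd hxy hcross hsum hEnd (hsymm b) (hnds b) (hadj b) hσ hε hp0 ⟨ρ, hρ, j, by rw [← hl b, hj]⟩
    obtain ⟨γ, hγW, -, hγ0⟩ := exists_isRationalClass_ne_zero_mem_weilClassesField hPm hPe hPirr hφ her
    have h0 : γ ∈ weilClassesField A φ P (2 * m) ⊓ divisorClassesSpan A.X A.dim m := ⟨hγW, hle hγW⟩
    rw [hbot, Submodule.mem_bot] at h0
    exact hγ0 h0

/-- **THE DICHOTOMY, EXCEPTIONAL SIDE: `W_F ⊗ ℂ ⊓ 𝒟ᵐ ⊗ ℂ = ⊥` IFF SOME EXPONENT `l_b(ρ)` IS ODD** (same hypotheses;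
`W_b ≠ 0` is part of «odd», an empty corner having exponent `0`).
[cite: MoonenZarhin1998WeilClasses, §1 Criterion (2) («this last possibility occurs precisely in the following cases: … Y is of Type 3, m ≥ 2 and the integer 2m·[E:ℚ]/[F:ℚ] is odd») and its proof (chunk p0003 L46–L60, L92–L111; p0004 L1–L27)]
[cite: Milne1999LefschetzClasses, §1 pp. 642–644, Thm. 3.2, Cor. 4.5] [cite: McconnellRobson2001, 3.5.5–3.5.7] -/
theorem weilClassesField_inf_divisorClassesSpan_eq_bot_iff_exists_odd_of_cornerForms (hPm : P.Monic)
    (hPe : P.natDegree = e) (hPirr : Irreducible (P.map (Int.castRingHom ℚ)))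
    (hφ : Polynomial.eval₂ (Int.castRingHom (CategoryTheory.End A)) (φ : CategoryTheory.End A) P = 0)
    (her : e * (2 * m) = 2 * A.dim) (hm : m ≠ 0) (hh : h ∈ hodgeClassSpan A.dim A.X 1)
    (hnd : ∀ v : complexBetti A.X 1, (∀ w, polarizationPairingOne A.X h (A.dim - 1) v w = 0) → v = 0)
    (hxy : ∀ b i j, y b i * x b j = if i = j then p b else 0)
    (hcross : ∀ b b', b ≠ b' → ∀ i j, y b i * x b' j = 0) (hsum : ∑ b, ∑ i, x b i * y b i = 1)
    (hx : ∀ b i, x b i ∈ Algebra.adjoin ℂ (Set.range fun χ : A ⟶ A ↦ pullbackOne A χ))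
    (hy : ∀ b i, y b i ∈ Algebra.adjoin ℂ (Set.range fun χ : A ⟶ A ↦ pullbackOne A χ))
    (hs : ∀ b, s b ∈ Algebra.adjoin ℂ (Set.range fun χ : A ⟶ A ↦ pullbackOne A χ))
    (hEnd : ∀ χ : A ⟶ A, pullbackOne A χ ∈ Submodule.span ℂ (Set.range fun t : κ × ι × ι ↦ x t.1 t.2.1 * y t.1 t.2.2))
    (hsymm : ∀ b, ∀ v ∈ LinearMap.range (p b), ∀ w ∈ LinearMap.range (p b),
      polarizationPairingOne A.X h (A.dim - 1) v (s b w) = polarizationPairingOne A.X h (A.dim - 1) w (s b v))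
    (hnds : ∀ b, ∀ v ∈ LinearMap.range (p b),
      (∀ w ∈ LinearMap.range (p b), polarizationPairingOne A.X h (A.dim - 1) v (s b w) = 0) → v = 0)
    (hadj : ∀ b k (v w : complexBetti A.X 1), polarizationPairingOne A.X h (A.dim - 1) (x b k v) w =
      ε k • polarizationPairingOne A.X h (A.dim - 1) v (s b (y b (σ k) w)))
    (hσ : Function.Involutive σ) (hε : ∀ k, ε (σ k) = -ε k) :
    weilClassesField A φ P (2 * m) ⊓ divisorClassesSpan A.X A.dim m = ⊥ ↔
      ∃ ρ : ℂ, Polynomial.eval₂ (Int.castRingHom ℂ) ρ P = 0 ∧ ∃ b, p b ≠ 0 ∧ ∃ j : ℕ,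
        Module.finrank ℂ ↥((pullbackOne A φ).eigenspace ρ ⊓ LinearMap.range (∑ i, x b i * y b i)) =
          (2 * j + 1) * Module.finrank ℂ (LinearMap.range (p b)) := by
  classical
  refine ⟨fun hbot ↦ ?_, fun ⟨ρ, hρ, b, hp0, j, hj⟩ ↦
    weilClassesField_inf_divisorClassesSpan_eq_bot_of_cornerForms_of_odd (b₀ := b) hPm hPe hPirr hφ her hm hh hnd hxy
      hcross hsum hEnd (hsymm b) (hnds b) (hadj b) hσ hε hp0 ⟨ρ, hρ, j, hj⟩⟩
  by_contra hne
  push Not at hne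
  haveI : Module.Finite ℂ (complexBetti A.X 1) := abelianVarietyCohomologyExteriorH1_holds.finite_one A
  have hle : weilClassesField A φ P (2 * m) ≤ divisorClassesSpan A.X A.dim m := by
    refine (weilClassesField_le_divisorClassesSpan_iff_forall_even_of_cornerForms hPm hPe hPirr hφ her hm hh hnd hxy hcross
      hsum hx hy hs hEnd hsymm hnds hadj hσ hε).2 fun ρ hρ b ↦ ?_
    obtain ⟨c, hcφ⟩ := exists_eq_sum_smul_of_mem_span_units_blocks (hEnd φ)
    obtain ⟨l, hl, -⟩ := exists_forall_det_restrict_eigenspace_eq_prod_pow hxy hcross hsum c hcφ ρ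
    obtain ⟨j, hj | hj⟩ := Nat.even_or_odd' (l b)
    · exact ⟨j, by rw [← hl b, hj]⟩
    · by_cases hp0 : p b = 0
      · refine ⟨0, ?_⟩
        rw [← hl b, hp0, LinearMap.range_zero, finrank_bot, mul_zero, mul_zero]
      · exact absurd (by rw [← hl b, hj]) (hne ρ hρ b hp0 j)
  obtain ⟨γ, hγW, -, hγ0⟩ := exists_isRationalClass_ne_zero_mem_weilClassesField hPm hPe hPirr hφ her
  have h0 : γ ∈ weilClassesField A φ P (2 * m) ⊓ divisorClassesSpan A.X A.dim m := ⟨hγW, hle hγW⟩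
  rw [hbot, Submodule.mem_bot] at h0
  exact hγ0 h0

end Blocks

/-! ### §3 One Morita datum with an orthogonal corner and its adjoint structure, split along the places of a
Rosati-symmetric centre: «odd exponent at some place ⟹ `W_F` exceptional» -/

open Polynomial

section Aeval

variable {M : Type*} [AddCommGroup M] [Module ℂ M]

/-- `L ∘ q(f) = q(g) ∘ L` when `L ∘ f = g ∘ L`. [folklore] -/
private theorem apply_aeval_of_comm'' {N : Type*} [AddCommGroup N] [Module ℂ N] (L : M →ₗ[ℂ] N) (f : Module.End ℂ M)
    (g : Module.End ℂ N) (hc : ∀ v, L (f v) = g (L v)) (q : ℂ[X]) (v : M) :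
    L (aeval f q v) = aeval g q (L v) := by
  induction q using Polynomial.induction_on' generalizing v with
  | add p q hp hq => rw [map_add, map_add, LinearMap.add_apply, LinearMap.add_apply, map_add, hp, hq]
  | monomial k c =>
    rw [aeval_monomial, aeval_monomial, Module.End.mul_apply, Module.End.mul_apply,
      Module.algebraMap_end_apply, Module.algebraMap_end_apply, map_smul]
    congr 1
    induction k generalizing v with
    | zero => rw [pow_zero, pow_zero, Module.End.one_apply, Module.End.one_apply]
    | succ k ih => rw [pow_succ, pow_succ, Module.End.mul_apply, Module.End.mul_apply, ih, hc]

/-- `q(T)` commutes with `U` when `T` does. [folklore] -/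
private theorem aeval_mul_comm_of_comm'' (T U : Module.End ℂ M) (hc : T * U = U * T) (q : ℂ[X]) :
    aeval T q * U = U * aeval T q := by
  refine LinearMap.ext fun v ↦ ?_
  rw [Module.End.mul_apply, Module.End.mul_apply]
  exact (apply_aeval_of_comm'' U T T (fun v ↦ by rw [← Module.End.mul_apply, ← hc, Module.End.mul_apply]) q v).symm

/-- A polynomial in a `B`-self-adjoint operator is `B`-self-adjoint, for any bilinear map `B`. [folklore] -/
private theorem bilin_aeval_symm'' {W : Type*} [AddCommGroup W] [Module ℂ W] (B : M →ₗ[ℂ] M →ₗ[ℂ] W)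
    (T : Module.End ℂ M) (hT : ∀ v w, B (T v) w = B v (T w)) (q : ℂ[X]) (v w : M) :
    B (aeval T q v) w = B v (aeval T q w) := by
  induction q using Polynomial.induction_on' generalizing v w with
  | add p q hp hq => rw [map_add, LinearMap.add_apply, LinearMap.add_apply, map_add, LinearMap.add_apply, map_add, hp, hq]
  | monomial k c =>
    rw [aeval_monomial, Module.End.mul_apply, Module.End.mul_apply, Module.algebraMap_end_apply,
      Module.algebraMap_end_apply, map_smul, LinearMap.smul_apply, map_smul]
    congr 1
    induction k generalizing v w with
    | zero => rw [pow_zero, Module.End.one_apply, Module.End.one_apply]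
    | succ k ih =>
      conv_lhs => rw [pow_succ', Module.End.mul_apply]
      rw [hT, ih, ← Module.End.mul_apply, ← pow_succ]

end Aeval

section MoritaCornerSymmetric

variable {X : AbelianVariety ℂ} {D : complexBetti X.X 2} {ι : Type*} [Fintype ι] [DecidableEq ι]
  {x y : ι → Module.End ℂ (complexBetti X.X 1)} {p t T : Module.End ℂ (complexBetti X.X 1)} {s : Finset ℂ}
  {φ : X ⟶ X} {P : Polynomial ℤ} {e m : ℕ} {σ : ι → ι} {ε : ι → ℂ}

/-- The block system of a Morita datum `(x, y, p)` split along the Lagrange projectors `P_z = ℓ_z(T)` of a commuting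
operator `T` with simple spectrum `s`: `(P_z xᵢ, P_z yᵢ, P_z p)_{z ∈ s}` is a system of matrix blocks with central
idempotents `Σᵢ (P_z xᵢ)(P_z yᵢ) = P_z`, whose units span a space containing `T` and every `x_a y_b`.
[cite: McconnellRobson2001, 3.5.5–3.5.7] [cite: HornJohnson2013, §1.1 and Thm. 1.3.7 ff.] -/
private theorem matrixBlocks_of_moritaData_of_centre' (hyx : ∀ i j, y i * x j = if i = j then p else 0)
    (hsum : ∑ i, x i * y i = 1) (hTx : ∀ i, T * x i = x i * T) (hTy : ∀ i, T * y i = y i * T) (hs : s.Nonempty)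
    (hTs : aeval T (Lagrange.nodal s id) = 0) {Pz : s → Module.End ℂ (complexBetti X.X 1)}
    (hPz : ∀ z, Pz z = aeval T (Lagrange.basis s id (z : ℂ))) :
    (∀ (z : s) i j, Pz z * y i * (Pz z * x j) = if i = j then Pz z * p else 0) ∧
    (∀ z z' : s, z ≠ z' → ∀ i j, Pz z * y i * (Pz z' * x j) = 0) ∧
    (∑ z : s, ∑ i, Pz z * x i * (Pz z * y i) = 1) ∧
    (∀ z : s, ∑ i, Pz z * x i * (Pz z * y i) = Pz z) ∧
    (insert T (Set.range fun ab : ι × ι ↦ x ab.1 * y ab.2) ⊆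
      (Submodule.span ℂ (Set.range fun w : s × ι × ι ↦ Pz w.1 * x w.2.1 * (Pz w.1 * y w.2.2)) :
        Set (Module.End ℂ (complexBetti X.X 1)))) := by
  classical
  obtain ⟨hPsum, hPorth, hPidem, hTP⟩ := aeval_lagrange_basis_spectral T s hs hTs
  have hPsum' : ∑ z : s, Pz z = 1 := by
    rw [← hPsum, ← Finset.sum_coe_sort s fun z ↦ aeval T (Lagrange.basis s id z)]
    exact Finset.sum_congr rfl fun z _ ↦ hPz z
  have hPidem' : ∀ z : s, Pz z * Pz z = Pz z := fun z ↦ by rw [hPz]; exact hPidem _ z.2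
  have hPorth' : ∀ z z' : s, z ≠ z' → Pz z * Pz z' = 0 := fun z z' hzz' ↦ by
    rw [hPz, hPz]; exact hPorth _ z.2 _ z'.2 fun e ↦ hzz' (Subtype.ext e)
  have hPx : ∀ (z : s) i, Pz z * x i = x i * Pz z := fun z i ↦ by
    rw [hPz]; exact aeval_mul_comm_of_comm'' T (x i) (hTx i) _
  have hPy : ∀ (z : s) i, Pz z * y i = y i * Pz z := fun z i ↦ by
    rw [hPz]; exact aeval_mul_comm_of_comm'' T (y i) (hTy i) _
  have hunit : ∀ (z : s) a b, Pz z * x a * (Pz z * y b) = Pz z * (x a * y b) := by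
    intro z a b
    rw [mul_assoc, ← mul_assoc (x a), ← hPx, mul_assoc, ← mul_assoc (Pz z), hPidem']
  have hQ : ∀ z : s, ∑ i, Pz z * x i * (Pz z * y i) = Pz z := fun z ↦ by
    simp_rw [hunit, ← Finset.mul_sum, hsum, mul_one]
  refine ⟨fun z i j ↦ ?_, fun z z' hzz' i j ↦ ?_, ?_, hQ, ?_⟩
  · rw [mul_assoc, ← mul_assoc (y i), ← hPy, mul_assoc, ← mul_assoc (Pz z), hPidem', hyx]
    split_ifs
    · rfl
    · rw [mul_zero]
  · rw [mul_assoc, ← mul_assoc (y i), ← hPy, mul_assoc, ← mul_assoc (Pz z), hPorth' z z' hzz', zero_mul]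
  · simp_rw [hQ]
    exact hPsum'
  · have hUmem : ∀ a b, x a * y b ∈ Submodule.span ℂ (Set.range fun w : s × ι × ι ↦ Pz w.1 * x w.2.1 * (Pz w.1 * y w.2.2)) := by
      intro a b
      have e1 : x a * y b = ∑ z : s, Pz z * x a * (Pz z * y b) := by
        simp_rw [hunit]
        rw [← Finset.sum_mul, hPsum', one_mul]
      rw [e1]
      exact Submodule.sum_mem _ fun z _ ↦ Submodule.subset_span ⟨(z, a, b), rfl⟩
    refine Set.insert_subset_iff.2 ⟨?_, ?_⟩
    · have e2 : T = ∑ z : s, ∑ i, (z : ℂ) • (Pz z * x i * (Pz z * y i)) := by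
        simp_rw [hunit, ← smul_mul_assoc, ← Finset.mul_sum, hsum, mul_one]
        rw [← mul_one T, ← hPsum', Finset.mul_sum]
        exact Finset.sum_congr rfl fun z _ ↦ by rw [hPz]; exact hTP _ z.2
      rw [e2]
      exact Submodule.sum_mem _ fun z _ ↦ Submodule.sum_mem _ fun i _ ↦
        Submodule.smul_mem _ _ (Submodule.subset_span ⟨(z, i, i), rfl⟩)
    · rintro _ ⟨ab, rfl⟩
      exact hUmem ab.1 ab.2

omit [Fintype ι] in
/-- The corners of the split system: `(P_z p) V = pV ∩ ker(T - z)`. [cite: McconnellRobson2001, 3.5.5–3.5.7] -/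
private theorem range_proj_mul_corner_eq' (hyx : ∀ i j, y i * x j = if i = j then p else 0)
    (hTx : ∀ i, T * x i = x i * T) (hTy : ∀ i, T * y i = y i * T) (hs : s.Nonempty)
    (hTs : aeval T (Lagrange.nodal s id) = 0) (i : ι) (z : s) :
    LinearMap.range (aeval T (Lagrange.basis s id (z : ℂ)) * p) = LinearMap.range p ⊓ T.eigenspace (z : ℂ) := by
  classical
  have hp : p = y i * x i := by rw [hyx, if_pos rfl]
  have hTp : T * p = p * T := by rw [hp, ← mul_assoc, hTy, mul_assoc, hTx, mul_assoc]
  have hPp : aeval T (Lagrange.basis s id (z : ℂ)) * p = p * aeval T (Lagrange.basis s id (z : ℂ)) :=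
    aeval_mul_comm_of_comm'' T p hTp _
  rw [← range_aeval_lagrange_basis_eq_eigenspace hs hTs z.2]
  refine le_antisymm ?_ ?_
  · rintro _ ⟨v, rfl⟩
    refine ⟨⟨aeval T (Lagrange.basis s id (z : ℂ)) v, ?_⟩, ⟨p v, rfl⟩⟩
    rw [← Module.End.mul_apply, ← hPp]
  · rintro v ⟨⟨v', hv'⟩, ⟨v'', hv''⟩⟩
    obtain ⟨-, -, hPidem, -⟩ := aeval_lagrange_basis_spectral T s hs hTs
    refine ⟨v', ?_⟩
    rw [Module.End.mul_apply, hv', ← hv'', ← Module.End.mul_apply, hPidem _ z.2]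

/-- **THE TYPE-3 MECHANISM WITH A ROSATI-SYMMETRIC CENTRE — ODD EXPONENT AT SOME PLACE ⟹ `W_F ⊗ ℂ ⊓ 𝒟ᵐ ⊗ ℂ = ⊥`.**
Let `X` be a complex abelian variety with `D ∈ B¹ ⊗ ℂ`, `Q_D` non-degenerate, `m ≠ 0`; `(x, y, p)` a MORITA DATUM over
`ι` (`yᵢ xⱼ = δᵢⱼ p`, `Σ xᵢ yᵢ = 1`) with an ORTHOGONAL CORNER and its ADJOINT STRUCTURE: an operator `t` with
`(v, w) ↦ Q_D(v, t w)` symmetric, non-degenerate on `W = pV`, and `Q_D(x_k v, w) = ε_k Q_D(v, t y_{σ(k)} w)` for an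
involution `σ` of `ι` with `ε_{σk} = -ε_k` (the datum `x = (p, tp)`, `y = (p, pt)`, `p = ½(1 + s)` of a Rosati-skew
anticommuting pair, and its matrix amplification on powers); `T` a `Q_D`-self-adjoint operator commuting with the
datum and with `t`, killed by the nodal polynomial of a finite `s ⊂ ℂ` (the totally real centre, place by place);
and EVERY pull-back `χ^*`, `χ ∈ End(X)`, in `ℂ⟨T, x_a y_b⟩` («`End⁰(X) = M_m(D)`, `E = Z(D)`»).  IF at some complex
root `ρ` of `P` and some place `z ∈ s` the corner `W ∩ ker(T - z)` is non-zero and `dim(V_ρ ∩ ker(T - z))` is an ODD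
multiple of `dim(W ∩ ker(T - z))`, THEN `W_F ⊗ ℂ ⊓ 𝒟ᵐ ⊗ ℂ = ⊥` — all non-zero Weil classes of `F = ℚ(φ)`
(`P(φ) = 0`, `P` monic irreducible of degree `e`, `e · 2m = 2 dim X`) are exceptional.  Proof: the blocks
`(P_z xᵢ, P_z yᵢ, P_z p)_z` inherit the corner operator `t` and the adjoint structure (`P_z` is `Q_D`-self-adjoint and
central), and §2 applies at the block `z`.  The print: «`W_F` consists of decomposable Hodge classes if and only if the
integer `2m[E:ℚ]/[F:ℚ]` is even», the exponent being read here at one place (module docstring of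
`WeilClassesFieldOrthogonalCornersParity`, «Relation to the print»).
[cite: MoonenZarhin1998WeilClasses, §1 Criterion (2), case «type 3, m ≥ 2» and its proof (chunk p0003 L46–L60, L92–L111; p0004 L1–L27); «α† = (α*ⱼᵢ)» (chunk p0002 L87–L90)]
[cite: Milne1999LefschetzClasses, §1 pp. 642–644, Thm. 3.2, Cor. 4.5] [cite: McconnellRobson2001, 3.5.5–3.5.7]
[cite: LangeBirkenhake1992, Ch. 5 §5 (type III, quaternion conjugation; PDF p. 138)] -/
theorem weilClassesField_inf_divisorClassesSpan_eq_bot_of_moritaData_of_cornerForm_of_symmetric_of_odd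
    (hPm : P.Monic) (hPe : P.natDegree = e) (hPirr : Irreducible (P.map (Int.castRingHom ℚ)))
    (hφ : Polynomial.eval₂ (Int.castRingHom (CategoryTheory.End X)) (φ : CategoryTheory.End X) P = 0)
    (her : e * (2 * m) = 2 * X.dim) (hm : m ≠ 0) (hh : D ∈ hodgeClassSpan X.dim X.X 1)
    (hnd : ∀ v : complexBetti X.X 1, (∀ w, polarizationPairingOne X.X D (X.dim - 1) v w = 0) → v = 0)
    (hyx : ∀ i j, y i * x j = if i = j then p else 0) (hsum : ∑ i, x i * y i = 1)
    (htsymm : ∀ v w : complexBetti X.X 1,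
      polarizationPairingOne X.X D (X.dim - 1) v (t w) = polarizationPairingOne X.X D (X.dim - 1) w (t v))
    (htnd : ∀ v ∈ LinearMap.range p,
      (∀ w ∈ LinearMap.range p, polarizationPairingOne X.X D (X.dim - 1) v (t w) = 0) → v = 0)
    (hadj : ∀ k (v w : complexBetti X.X 1), polarizationPairingOne X.X D (X.dim - 1) (x k v) w =
      ε k • polarizationPairingOne X.X D (X.dim - 1) v (t (y (σ k) w)))
    (hσ : Function.Involutive σ) (hε : ∀ k, ε (σ k) = -ε k)
    (hTadj : ∀ v w : complexBetti X.X 1,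
      polarizationPairingOne X.X D (X.dim - 1) (T v) w = polarizationPairingOne X.X D (X.dim - 1) v (T w))
    (hTx : ∀ i, T * x i = x i * T) (hTy : ∀ i, T * y i = y i * T) (hTt : T * t = t * T)
    (hs : s.Nonempty) (hTs : aeval T (Lagrange.nodal s id) = 0)
    (hEnd : ∀ χ : X ⟶ X, pullbackOne X χ ∈ Algebra.adjoin ℂ
      (insert T (Set.range fun ab : ι × ι ↦ x ab.1 * y ab.2) : Set (Module.End ℂ (complexBetti X.X 1))))
    (hodd : ∃ ρ : ℂ, Polynomial.eval₂ (Int.castRingHom ℂ) ρ P = 0 ∧ ∃ z ∈ s,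
      LinearMap.range p ⊓ T.eigenspace z ≠ ⊥ ∧ ∃ j : ℕ,
        Module.finrank ℂ ↥((pullbackOne X φ).eigenspace ρ ⊓ T.eigenspace z) =
          (2 * j + 1) * Module.finrank ℂ ↥(LinearMap.range p ⊓ T.eigenspace z)) :
    weilClassesField X φ P (2 * m) ⊓ divisorClassesSpan X.X X.dim m = ⊥ := by
  classical
  obtain ⟨ρ, hρ, z₀, hz₀, hW0, j, hj⟩ := hodd
  -- `ι` is non-empty (else `1 = 0` on `H¹` and the corner is zero)
  rcases isEmpty_or_nonempty ι with hι | ⟨⟨i₀⟩⟩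
  · have h10 : (1 : Module.End ℂ (complexBetti X.X 1)) = 0 := by rw [← hsum]; exact Fintype.sum_empty _
    haveI : Subsingleton (complexBetti X.X 1) := ⟨fun a b ↦ by
      rw [← Module.End.one_apply (R := ℂ) a, ← Module.End.one_apply (R := ℂ) b, h10, LinearMap.zero_apply,
        LinearMap.zero_apply]⟩
    exact absurd (Subsingleton.elim _ _) hW0
  -- the Lagrange projectors, kept opaque
  obtain ⟨Pz, hPz⟩ : ∃ Pz : s → Module.End ℂ (complexBetti X.X 1), ∀ z, Pz z = aeval T (Lagrange.basis s id (z : ℂ)) :=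
    ⟨_, fun _ ↦ rfl⟩
  obtain ⟨hxy', hcross, hsum', hQ, hgen⟩ := matrixBlocks_of_moritaData_of_centre' hyx hsum hTx hTy hs hTs hPz
  obtain ⟨hPsum, hPorth, hPidem, -⟩ := aeval_lagrange_basis_spectral T s hs hTs
  have hPidem' : ∀ z : s, Pz z * Pz z = Pz z := fun z ↦ by rw [hPz]; exact hPidem _ z.2
  have hPorth' : ∀ z z' : s, z ≠ z' → Pz z * Pz z' = 0 := fun z z' hzz' ↦ by
    rw [hPz, hPz]; exact hPorth _ z.2 _ z'.2 fun e ↦ hzz' (Subtype.ext e)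
  have hPsum' : ∑ z : s, Pz z = 1 := by
    rw [← hPsum, ← Finset.sum_coe_sort s fun z ↦ aeval T (Lagrange.basis s id z)]
    exact Finset.sum_congr rfl fun z _ ↦ hPz z
  have hPadj : ∀ (z : s) (v w : complexBetti X.X 1), polarizationPairingOne X.X D (X.dim - 1) (Pz z v) w =
      polarizationPairingOne X.X D (X.dim - 1) v (Pz z w) := fun z v w ↦ by
    rw [hPz]; exact bilin_aeval_symm'' _ T hTadj _ v w
  have hPt : ∀ z : s, Pz z * t = t * Pz z := fun z ↦ by rw [hPz]; exact aeval_mul_comm_of_comm'' T t hTt _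
  have hPy : ∀ (z : s) i, Pz z * y i = y i * Pz z := fun z i ↦ by
    rw [hPz]; exact aeval_mul_comm_of_comm'' T (y i) (hTy i) _
  have hp : p = y i₀ * x i₀ := by rw [hyx, if_pos rfl]
  have hTp : T * p = p * T := by rw [hp, ← mul_assoc, hTy, mul_assoc, hTx, mul_assoc]
  have hPp : ∀ z : s, Pz z * p = p * Pz z := fun z ↦ by rw [hPz]; exact aeval_mul_comm_of_comm'' T p hTp _
  have hcorner : ∀ z : s, LinearMap.range (Pz z * p) = LinearMap.range p ⊓ T.eigenspace (z : ℂ) := fun z ↦ by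
    rw [hPz]; exact range_proj_mul_corner_eq' hyx hTx hTy hs hTs i₀ z
  refine weilClassesField_inf_divisorClassesSpan_eq_bot_of_cornerForms_of_odd (κ := s) (s := fun _ ↦ t)
    (x := fun z i ↦ Pz z * x i) (y := fun z i ↦ Pz z * y i) (p := fun z ↦ Pz z * p) (b₀ := ⟨z₀, hz₀⟩) (σ := σ) (ε := ε)
    hPm hPe hPirr hφ her hm hh hnd hxy' hcross hsum'
    (fun χ ↦ adjoin_le_span_units_of_matrixBlocks hxy' hcross hsum' hgen (hEnd χ)) (fun v _ w _ ↦ htsymm v w)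
    (fun v hv h0 ↦ ?_) (fun k v w ↦ ?_) hσ hε ?_ ⟨ρ, hρ, j, ?_⟩
  · -- non-degeneracy of `Q_D(·, t ·)` on the sub-corner `(P_z p)V = P_z (pV)`
    set z : s := ⟨z₀, hz₀⟩
    obtain ⟨v', rfl⟩ := hv
    have hv1 : Pz z ((Pz z * p) v') = (Pz z * p) v' := by rw [← Module.End.mul_apply, ← mul_assoc, hPidem']
    have hkill : ∀ z' : s, z' ≠ z → Pz z' ((Pz z * p) v') = 0 := fun z' hz' ↦ by
      rw [← hv1, ← Module.End.mul_apply, hPorth' z' z hz', LinearMap.zero_apply]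
    refine htnd _ ⟨Pz z v', by rw [← Module.End.mul_apply, ← hPp]⟩ fun w hw ↦ ?_
    obtain ⟨w', rfl⟩ := hw
    have hsplit : p w' = ∑ z' : s, Pz z' (p w') := by
      rw [← LinearMap.sum_apply, hPsum', Module.End.one_apply]
    have hterm : ∀ z' : s, z' ≠ z →
        polarizationPairingOne X.X D (X.dim - 1) ((Pz z * p) v') (t (Pz z' (p w'))) = 0 := by
      intro z' hz'
      calc polarizationPairingOne X.X D (X.dim - 1) ((Pz z * p) v') (t (Pz z' (p w')))
          = polarizationPairingOne X.X D (X.dim - 1) ((Pz z * p) v') (Pz z' (t (p w'))) := by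
            rw [← Module.End.mul_apply t, ← hPt, Module.End.mul_apply (Pz z') t]
        _ = polarizationPairingOne X.X D (X.dim - 1) (Pz z' ((Pz z * p) v')) (t (p w')) := by rw [hPadj]
        _ = 0 := by rw [hkill z' hz', LinearMap.map_zero₂]
    rw [hsplit, map_sum, map_sum, Finset.sum_eq_single z (fun z' _ hz' ↦ hterm z' hz')
      fun hz ↦ absurd (Finset.mem_univ z) hz]
    exact h0 _ ⟨w', by rw [Module.End.mul_apply]⟩
  · -- the adjoint structure of the split units: `P_z` is self-adjoint and commutes with the `y_i`
    rw [Module.End.mul_apply, hPadj, hadj, hPy, Module.End.mul_apply]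
  · -- the corner at `z₀` is non-zero
    intro h0
    apply hW0
    rw [← hcorner ⟨z₀, hz₀⟩, h0, LinearMap.range_zero]
  · -- the exponent hypothesis, transported to the blocks: `Q_z = P_z`, `(P_z p)V = W ∩ ker(T - z)`
    rw [hQ, hcorner, hPz, range_aeval_lagrange_basis_eq_eigenspace hs hTs hz₀]
    exact hj

end MoritaCornerSymmetric

end Literature.AlgebraicGeometry.HodgeTheory

end
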